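import Literature.MathematicalPhysics.QuantumLattice.SpinChainsLemmMozgunovProofs
import HarnessLib

/-!
# A finite-size criterion for frustration-free nearest-neighbour systems on the periodic SQUARE LATTICE
# (Lemm–Xiang's "general gap bound on the Euclidean lattice", Prop. 3.1, for `D = 2`; Gosset–Mozgunov Thm. 5)

Census row **B15** (cell `ym-ir`, finite-size criteria / finite-size scaling), third instalment: the two-dimensional
finite-size criterion.  Companion of `SpinChainsKnabeBlockProofs`, `SpinChainsGossetMozgunovProofs` (periodic chains)
and `SpinChainsLemmMozgunovProofs` (open chains).  THEOREMS ONLY — this file introduces no definition and no named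
fact (D-0014/D-0026: net debt delta 0).

## The sources, as printed

* **Lemm–Xiang 2022**, Thm. (main result on Euclidean lattices) [cite: LemmXiang2022, §2.1 Theorem]: for a
  frustration-free nearest-neighbour Hamiltonian `H_{Λ_L} = Σ_x Σ_j h_{x,e_j}` of orthogonal projections on the torus
  `Λ_L = (ℤ/L)^D`, `D ≥ 2`, `L ≥ 5`, `2 ≤ ℓ < L/2`: `γ_L^per ≥ (5/6)^D (γ_ℓ - t_ℓ)` with
  `t_ℓ = (6/5)^D (5/ℓ² + 300/ℓ³)` for `ℓ ≥ 10`, `γ_ℓ` the gap of the open box `B_ℓ = {0,…,ℓ}^D` (ℓ bonds per side).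
  It is obtained by optimising the weights in
* **Lemm–Xiang 2022, Prop. 3.1** (general gap bound on the Euclidean lattice) [cite: LemmXiang2022, §3.1 Proposition]:
  for weights `c_0,…,c_{ℓ-1}`, `d_0,…,d_ℓ` (positive, symmetric, increasing to the midpoint) and the weighted box
  Hamiltonian `W_{B_ℓ} = Σ_j Σ_x c_{x_j} (Π_{k≠j} d_{x_k}) h_{x,e_j}`:
  `γ_L^per ≥ (K₄/K₃)(γ_ℓ - (K₀ + K₃ - 2K₁)/K₄)` provided `K₃ ≥ max{K₁, K₂}`, where for `D = 2`
  `K₀ = (Σc_i²)(Σd_i²)`, `K₃ = (Σ_{i<ℓ} c_i d_i)²`, `K₄ = (Σc_i)²(Σd_i)²/(ℓ(ℓ+1))`, and `{K₁, K₂}` are the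
  collinear-adjacent coefficient `(Σ_{i ≤ ℓ-2} c_i c_{i+1})(Σ d_i²)` and the parallel-adjacent coefficient
  `(Σ c_i²)(Σ_{i<ℓ} d_i d_{i+1})`.  NOTE: the displayed statement of Prop. 3.1 (p. 7) and its proof (§3.2, p. 8)
  label these two the opposite way; the proof (§3.3: "each edge is contained in precisely two bond pairs of the
  [collinear] shape") shows that the `K₁` entering the threshold is the COLLINEAR-adjacent coefficient, and that is
  what is proved below (`hK₁`).  Proof architecture (§3.2–§3.5): expand the auxiliary operator `A = Σ_t W_{B_t}²`
  in anticommutators with effective weights `w_{x,y,j,k}` (products of one-dimensional autocorrelation sums,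
  monotone in the distance, maximal `K₁, K₂, K₃` on adjacent pairs), compare with `H²` termwise, bound the
  collinear anticommutators below by `-2H` (operator Cauchy–Schwarz, an idea of [L2]), and finally bound `A` from
  below by `ε K₄ H_{Λ_L}… ` on a translation-invariant excited state (Lemma 3, after Gosset–Mozgunov's Lemma 6).
* **Gosset–Mozgunov 2016, Thm. 5** [cite: GossetMozgunov2016, §3 Theorem 5]: `ε_m^T ≥ (3/4)(ε_n^P - 8/n²)` for even
  `n > 2`, `m > 2(n+2)`, patches `P_n` (n × (n+2) grid minus the outer vertical edges) — the first `ℓ⁻²` threshold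
  in two dimensions; [cite: Knabe1988, §2] is the original `Θ(ℓ⁻¹)` criterion, [cite: Anshu2020, Theorem 1] the
  information-theoretic `D`-dimensional one.

## What is proved here (complete proofs), and how it deviates

★ `squareLattice_sq_sub_smul_posSemidef` — Prop. 3.1 for `D = 2` as an OPERATOR inequality
`H² - (K₄/K₃)(ε - (K₀+K₃-2K₁)/K₄) H ≥ 0` for `H = Σ_x (P₀ x + P₁ x)` on the torus `(ℤ/L)²` (horizontal bond
projections `P₀ x` on `{x, x+e₁}`, vertical `P₁ x` on `{x, x+e₂}`, encoded only through the commutation hypotheses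
`hc00 … hc10` of non-adjacent bonds), local gap `ε` of every translated open box (hypothesis `hloc`, the box
Hamiltonian written out), `1 ≤ ℓ`, `2ℓ + 2 ≤ L`.  Deviations, all on the safe side: (1) NO translation invariance and
no choice of eigenvector — Lemma 3 is replaced by the summed spectral Cauchy–Schwarz inequality
`family_sum_sq_sub_smul_posSemidef` (every block, every vector), so the conclusion is an operator inequality and the
eigenvalue reading (`eigenvalue_eq_zero_or_le_of_sq_sub_smul_posSemidef`) gives the printed gap statement; (2) the
weight conditions (i)–(iii) are replaced by exactly the four autocorrelation inequalities the proof uses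
(`hcc hdd hcd hdc`, "monotonically decreasing in the distances", §3.2) plus the corner symmetry `hX1`
(`Σ c_i d_{i+1} = Σ c_i d_i`, "relabelling the summation indices", §3.2) — for symmetric unimodal weights these are
the printed consequences, and they are discharged explicitly for the concrete weights below; (3) `L ≥ 2ℓ + 2`
(one more than the printed `ℓ < L/2`) keeps all shifted autocorrelations inside one period.
★ `squareLattice_sq_sub_smul_posSemidef_unitWeights` — the case `c ≡ d ≡ 1`:
`H² - ((ℓ+1)/ℓ)(ε - (ℓ+2)/(ℓ(ℓ+1))) H ≥ 0`, a Knabe-type `Θ(ℓ⁻¹)` threshold on the square lattice, and its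
eigenvalue reading `…_unitWeights_eigenvalue_eq_zero_or_le`.
★ `squareLattice_sq_sub_smul_posSemidef_gmWeights_exact` / `…_gmWeights` / `…_gmWeights_eigenvalue_eq_zero_or_le`
— the `ℓ⁻²` criterion: with the product weights `c_i = (i+1)(ℓ-i)`, `d_i = (i+1)(ℓ+1-i)` (Lemm–Xiang's
eq. (cjchoice) at `λ = 0`, the Gosset–Mozgunov-type quadratic profile) all of `K₀,…,K₄` are evaluated in closed
form (§9: Faulhaber master sum `gm_sum_master`, the monotonicity inequalities with explicit positive polynomial
certificates), giving `H² - (25(ℓ+1)(ℓ+2)²/(9ℓ(2ℓ+3)²))(ε - 9(5ℓ²+23ℓ+32)/(5(ℓ+1)(ℓ+2)²(ℓ+3))) H ≥ 0` and the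
rounded form `H² - (25/36)(ε - 9/ℓ²) H ≥ 0` for EVERY `ℓ ≥ 1`, `L ≥ 2ℓ + 2`.  The constants differ from the printed
ones, honestly: Lemm–Xiang's optimised weights (`λ = 2(√2-1)/ℓ`, "various elementary estimates", `ℓ ≥ 10`) give
the threshold `7.2/ℓ² + 432/ℓ³`, asymptotically better than `9/ℓ²` (but larger for `ℓ < 240`); Gosset–Mozgunov's
`8/n²` is for their `n × (n+2)` patches with `n(n+2)` sites.  Neither printed constant is restated as a fact.

Honest framing (cell rule): these are finite-size criteria for frustration-free lattice Hamiltonians; nothing here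
bears on the Clay Yang–Mills mass-gap problem, and R4 of the cell closes only the conditional finite-`𝕋⁴` rung
`BalabanLadder.UV`.

## References
[cite: LemmXiang2022, §2.1 Thm. (main), §3.1 Prop. 3.1, §3.2–§3.5] · [cite: GossetMozgunov2016, §3 Thm. 5, Lemma 6] ·
[cite: Knabe1988, §2] · [cite: Anshu2020, Thm. 1]
-/

noncomputable section

open Matrix Complex Finset
open scoped ComplexOrder

namespace Literature.MathematicalPhysics.QuantumLattice

section SquareLattice

variable {n : Type*} [Fintype n] [DecidableEq n]

/-! ### §1 The summed spectral Cauchy–Schwarz inequality for an arbitrary family of blocks -/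

omit [DecidableEq n] in
/-- Quadratic forms of positive matrices are real. [folklore] -/
private theorem dotProduct_mulVec_eq_re' {M : Matrix n n ℂ} (hM : M.PosSemidef) (φ : n → ℂ) :
    star φ ⬝ᵥ (M *ᵥ φ) = (((star φ ⬝ᵥ (M *ᵥ φ)).re : ℝ) : ℂ) := by
  have h := Complex.nonneg_iff.1 (hM.dotProduct_mulVec_nonneg φ)
  exact Complex.ext (by simp) (by rw [Complex.ofReal_im]; exact h.2.symm)

omit [DecidableEq n] in
/-- `⟨φ, Mᴴ φ⟩ = conj ⟨φ, M φ⟩`. [folklore] -/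
private theorem dotProduct_conjTranspose_mulVec (M : Matrix n n ℂ) (φ : n → ℂ) :
    star φ ⬝ᵥ (Mᴴ *ᵥ φ) = star (star φ ⬝ᵥ (M *ᵥ φ)) := by
  rw [dotProduct_mulVec, ← star_mulVec, star_dotProduct]

omit [DecidableEq n] in
/-- Quadratic forms of Hermitian matrices are real. [folklore] -/
private theorem dotProduct_mulVec_eq_re_of_isHermitian {M : Matrix n n ℂ} (hM : M.IsHermitian) (φ : n → ℂ) :
    star φ ⬝ᵥ (M *ᵥ φ) = (((star φ ⬝ᵥ (M *ᵥ φ)).re : ℝ) : ℂ) := by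
  have h : star (star φ ⬝ᵥ (M *ᵥ φ)) = star φ ⬝ᵥ (M *ᵥ φ) := by
    rw [← dotProduct_conjTranspose_mulVec, hM.eq]
  exact (Complex.conj_eq_iff_re.1 h).symm

omit [DecidableEq n] in
/-- `⟨φ, B²φ⟩ = ⟨Bφ, Bφ⟩` for Hermitian `B`. [folklore] -/
private theorem dotProduct_mulVec_mul_self' {B : Matrix n n ℂ} (hB : B.IsHermitian) (φ : n → ℂ) :
    star φ ⬝ᵥ ((B * B) *ᵥ φ) = star (B *ᵥ φ) ⬝ᵥ (B *ᵥ φ) := by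
  rw [← mulVec_mulVec, dotProduct_mulVec, star_mulVec, hB.eq]

/-- **Summed spectral Cauchy–Schwarz inequality for an arbitrary finite family of blocks** (the translation-free
form of Gosset–Mozgunov's Lemma 4 / Lemma 6 and of Lemm–Xiang's Lemma 3, generalising the tree's ring version
`gossetMozgunov_sum_weighted_sq_sub_smul_posSemidef`): if `H ≥ 0`, every block `A_t ≥ 0` has the local gap
`A_t² ≥ εA_t`, every weighted block `B_t` is Hermitian with `ker A_t ⊆ ker B_t`, and `Σ_t A_t = κ_A H`,
`Σ_t B_t = κ_B H` with `κ_A > 0`, then `Σ_t B_t² ≥ ε (κ_B²/κ_A) H` — for EVERY vector, by the per-block estimate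
`ε|⟨φ,B_tφ⟩|² ≤ ⟨φ,A_tφ⟩‖B_tφ‖²` (`eps_mul_normSq_dotProduct_le`) and the Cauchy–Schwarz inequality across blocks;
no translation invariance and no choice of eigenvector is needed.
[cite: GossetMozgunov2016, §3.1 Lemma 6] [cite: LemmXiang2022, §3.4 Lemma 3, §3.5] -/
theorem family_sum_sq_sub_smul_posSemidef {ι : Type*} [Fintype ι] {H : Matrix n n ℂ} (hH : H.PosSemidef)
    (A B : ι → Matrix n n ℂ) (hA : ∀ t, (A t).PosSemidef) (hB : ∀ t, (B t).IsHermitian) {ε : ℝ}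
    (hε : 0 < ε) (hgap : ∀ t, (A t * A t - (ε : ℂ) • A t).PosSemidef)
    (hker : ∀ t (v : n → ℂ), A t *ᵥ v = 0 → B t *ᵥ v = 0) {κA κB : ℝ} (hκA : 0 < κA)
    (hsumA : ∑ t, A t = (κA : ℂ) • H) (hsumB : ∑ t, B t = (κB : ℂ) • H) :
    (∑ t, B t * B t - ((ε * κB ^ 2 / κA : ℝ) : ℂ) • H).PosSemidef := by
  set κ : ℝ := ε * κB ^ 2 / κA with hκ
  have hBBpos : ∀ t, (B t * B t).PosSemidef := by
    intro t
    have h := posSemidef_conjTranspose_mul_self (B t)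
    rwa [(hB t).eq] at h
  have hXpos : (∑ t, B t * B t).PosSemidef := posSemidef_sum _ fun t _ => hBBpos t
  have hκ0 : 0 ≤ κ := by rw [hκ]; positivity
  refine PosSemidef.of_dotProduct_mulVec_nonneg (hXpos.1.sub (hH.smul (Complex.zero_le_real.2 hκ0)).1)
    fun φ => ?_
  -- real quantities
  set aH : ℝ := (star φ ⬝ᵥ (H *ᵥ φ)).re with haH
  set a : ι → ℝ := fun t => (star φ ⬝ᵥ (A t *ᵥ φ)).re with ha
  set x : ι → ℝ := fun t => (star φ ⬝ᵥ (B t *ᵥ φ)).re with hx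
  set y : ι → ℝ := fun t => (star (B t *ᵥ φ) ⬝ᵥ (B t *ᵥ φ)).re with hy
  have haH0 : 0 ≤ aH := (Complex.nonneg_iff.1 (hH.dotProduct_mulVec_nonneg φ)).1
  have ha0 : ∀ t, 0 ≤ a t := fun t => (Complex.nonneg_iff.1 ((hA t).dotProduct_mulVec_nonneg φ)).1
  have hy0 : ∀ t, 0 ≤ y t := fun t => (Complex.nonneg_iff.1 (dotProduct_star_self_nonneg _)).1
  -- per block: `ε x_t² ≤ a_t y_t`
  have hblock : ∀ t, x t ^ 2 ≤ (a t / ε) * y t := by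
    intro t
    have h := eps_mul_normSq_dotProduct_le (hA t) hε (hgap t) (hB t) (hker t) φ
    have hxle : x t ^ 2 ≤ ‖star φ ⬝ᵥ (B t *ᵥ φ)‖ ^ 2 := by
      rw [hx, sq_le_sq, abs_norm]
      exact Complex.abs_re_le_norm _
    rw [div_mul_eq_mul_div, le_div_iff₀ hε]
    calc x t ^ 2 * ε = ε * x t ^ 2 := by ring
      _ ≤ ε * ‖star φ ⬝ᵥ (B t *ᵥ φ)‖ ^ 2 := mul_le_mul_of_nonneg_left hxle hε.le
      _ ≤ a t * y t := h
  -- Cauchy–Schwarz across the blocks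
  have hCS : (∑ t, x t) ^ 2 ≤ (∑ t, a t / ε) * ∑ t, y t :=
    sum_sq_le_sum_mul_sum_of_sq_le_mul _ (fun t _ => div_nonneg (ha0 t) hε.le) (fun t _ => hy0 t)
      fun t _ => hblock t
  -- the sums: `Σ x_t = κB aH`, `Σ a_t = κA aH`, `Σ y_t = ⟨φ, (Σ B_t²) φ⟩`
  have hsumx : ∑ t, x t = κB * aH := by
    have h : ∑ t, star φ ⬝ᵥ (B t *ᵥ φ) = ((κB : ℝ) : ℂ) * (star φ ⬝ᵥ (H *ᵥ φ)) := by
      rw [← dotProduct_sum, ← sum_mulVec, hsumB, smul_mulVec, dotProduct_smul, smul_eq_mul]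
    simp only [hx, haH]
    rw [← Complex.re_sum, h, Complex.re_ofReal_mul]
  have hsuma : ∑ t, a t = κA * aH := by
    have h : ∑ t, star φ ⬝ᵥ (A t *ᵥ φ) = ((κA : ℝ) : ℂ) * (star φ ⬝ᵥ (H *ᵥ φ)) := by
      rw [← dotProduct_sum, ← sum_mulVec, hsumA, smul_mulVec, dotProduct_smul, smul_eq_mul]
    simp only [ha, haH]
    rw [← Complex.re_sum, h, Complex.re_ofReal_mul]
  have hsumy : star φ ⬝ᵥ ((∑ t, B t * B t) *ᵥ φ) = (((∑ t, y t : ℝ)) : ℂ) := by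
    rw [sum_mulVec, dotProduct_sum]
    push_cast
    refine Finset.sum_congr rfl fun t _ => ?_
    rw [dotProduct_mulVec_eq_re' (hBBpos t) φ, dotProduct_mulVec_mul_self' (hB t)]
  -- the real inequality `κ aH ≤ Σ y`
  have hysum0 : 0 ≤ ∑ t, y t := Finset.sum_nonneg fun t _ => hy0 t
  have hmain : κ * aH ≤ ∑ t, y t := by
    have hCS' : (κB * aH) ^ 2 ≤ (κA * aH / ε) * ∑ t, y t := by
      have h := hCS
      rwa [hsumx, ← Finset.sum_div, hsuma] at h
    rcases haH0.eq_or_lt with h0 | hpos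
    · rw [← h0, mul_zero]; exact hysum0
    · have h2 : (κB * aH) ^ 2 * ε ≤ (κA * aH) * ∑ t, y t := by
        calc (κB * aH) ^ 2 * ε ≤ ((κA * aH / ε) * ∑ t, y t) * ε :=
              mul_le_mul_of_nonneg_right hCS' hε.le
          _ = (κA * aH) * ∑ t, y t := by field_simp
      have h3 : κB ^ 2 * ε * aH ≤ κA * ∑ t, y t := by
        have h2' : aH * (κB ^ 2 * ε * aH) ≤ aH * (κA * ∑ t, y t) := by nlinarith [h2]
        exact le_of_mul_le_mul_left h2' hpos
      rw [hκ, div_mul_eq_mul_div, div_le_iff₀ hκA]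
      nlinarith [h3]
  rw [sub_mulVec, dotProduct_sub, smul_mulVec, dotProduct_smul, smul_eq_mul, hsumy,
    dotProduct_mulVec_eq_re' hH φ, ← Complex.ofReal_mul, ← Complex.ofReal_sub, Complex.zero_le_real]
  linarith [hmain]

/-! ### §2 Real parts of pair terms `⟨φ, P Q φ⟩` for orthogonal projections -/

omit [DecidableEq n] in
/-- For commuting orthogonal projections `P`, `Q`: `Re ⟨φ, PQ φ⟩ ≥ 0` (`PQ ≥ 0`). [folklore] -/
private theorem re_pair_nonneg_of_commute {P Q : Matrix n n ℂ} (hP : P.IsHermitian) (hPP : P * P = P)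
    (hQ : Q.IsHermitian) (hQQ : Q * Q = Q) (hPQ : P * Q = Q * P) (φ : n → ℂ) :
    0 ≤ (star φ ⬝ᵥ ((P * Q) *ᵥ φ)).re :=
  (Complex.nonneg_iff.1 ((posSemidef_mul_of_commute hP hPP hQ hQQ hPQ).dotProduct_mulVec_nonneg φ)).1

omit [DecidableEq n] in
/-- The operator Cauchy–Schwarz step `{P, Q} ≥ -(P + Q)` for orthogonal projections, in quadratic form:
`2 Re⟨φ, PQφ⟩ ≥ -(⟨φ,Pφ⟩ + ⟨φ,Qφ⟩)` (from `(P + Q)² ≥ 0`).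
[cite: LemmXiang2022, §3.3 (operator Cauchy–Schwarz inequality)] -/
private theorem two_mul_re_pair_ge {P Q : Matrix n n ℂ} (hP : P.IsHermitian) (hPP : P * P = P)
    (hQ : Q.IsHermitian) (hQQ : Q * Q = Q) (φ : n → ℂ) :
    -((star φ ⬝ᵥ (P *ᵥ φ)).re + (star φ ⬝ᵥ (Q *ᵥ φ)).re) ≤
      2 * (star φ ⬝ᵥ ((P * Q) *ᵥ φ)).re := by
  have hPQh : (P + Q).IsHermitian := hP.add hQ
  -- `0 ≤ ⟨φ, (P+Q)² φ⟩ = ⟨φ,Pφ⟩ + ⟨φ,Qφ⟩ + ⟨φ,PQφ⟩ + ⟨φ,QPφ⟩`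
  have h0 : 0 ≤ (star φ ⬝ᵥ (((P + Q) * (P + Q)) *ᵥ φ)).re := by
    rw [dotProduct_mulVec_mul_self' hPQh]
    exact (Complex.nonneg_iff.1 (dotProduct_star_self_nonneg _)).1
  have hexp : (P + Q) * (P + Q) = P + Q + P * Q + Q * P := by
    rw [add_mul, mul_add, mul_add, hPP, hQQ]; abel
  -- `⟨φ, QP φ⟩ = conj ⟨φ, PQ φ⟩`
  have hQP : (star φ ⬝ᵥ ((Q * P) *ᵥ φ)).re = (star φ ⬝ᵥ ((P * Q) *ᵥ φ)).re := by
    have h : Q * P = (P * Q)ᴴ := by rw [conjTranspose_mul, hP.eq, hQ.eq]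
    rw [h, dotProduct_conjTranspose_mulVec, Complex.star_def, Complex.conj_re]
  rw [hexp, add_mulVec, add_mulVec, add_mulVec, dotProduct_add, dotProduct_add, dotProduct_add,
    Complex.add_re, Complex.add_re, Complex.add_re, hQP] at h0
  linarith

/-! ### §3 Sums over `ℤ/L` of periodised finitely supported sequences -/

/-- `Σ_{s : ℤ/L} F(s.val) = Σ_{i<L} F(i)`. [folklore] -/
private theorem sum_zmod_val {L : ℕ} [NeZero L] {M : Type*} [AddCommMonoid M] (F : ℕ → M) :
    ∑ s : ZMod L, F s.val = ∑ i ∈ range L, F i := by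
  refine Finset.sum_nbij (fun s => s.val) (fun s _ => mem_range.2 (ZMod.val_lt s)) ?_ ?_ (fun _ _ => rfl)
  · intro s _ s' _ h
    exact ZMod.val_injective L h
  · intro i hi
    refine ⟨(i : ZMod L), mem_coe.2 (mem_univ _), ?_⟩
    simp only [ZMod.val_natCast, Nat.mod_eq_of_lt (mem_range.1 (mem_coe.1 hi))]

/-- The periodisation of a sequence supported on `[0, m)`, `m ≤ L`, sums to `Σ_{i<m} f i`. [folklore] -/
private theorem sum_per {L : ℕ} [NeZero L] {m : ℕ} (hm : m ≤ L) (f : ℕ → ℝ) :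
    ∑ s : ZMod L, (if s.val < m then f s.val else 0) = ∑ i ∈ range m, f i := by
  rw [sum_zmod_val (fun i => if i < m then f i else 0), ← Finset.sum_filter]
  congr 1
  ext i
  simp only [mem_filter, mem_range]
  omega

/-- **Forward correlations without wrap-around**: for `t + m ≤ L`,
`Σ_{s : ℤ/L} f̂(s) ĝ(s + t) = Σ_{i<m, i+t<m'} f(i) g(i+t)` (`f̂`, `ĝ` the periodisations of sequences supported on
`[0,m)`, `[0,m')`). [folklore] -/
private theorem sum_per_mul_per_add {L : ℕ} [NeZero L] {m m' t : ℕ} (hm : t + m ≤ L) (f g : ℕ → ℝ) :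
    ∑ s : ZMod L, (if s.val < m then f s.val else 0) *
        (if (s + (t : ZMod L)).val < m' then g (s + (t : ZMod L)).val else 0) =
      ∑ i ∈ range m, if i + t < m' then f i * g (i + t) else 0 := by
  have hkey : ∀ s : ZMod L, (if s.val < m then f s.val else 0) *
      (if (s + (t : ZMod L)).val < m' then g (s + (t : ZMod L)).val else 0) =
      (if s.val < m then (if s.val + t < m' then f s.val * g (s.val + t) else 0) else 0) := by
    intro s
    by_cases hs : s.val < m
    · have hval : (s + (t : ZMod L)).val = s.val + t := by
        rw [ZMod.val_add, ZMod.val_natCast, Nat.mod_eq_of_lt (by omega : t < L),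
          Nat.mod_eq_of_lt (by omega : s.val + t < L)]
      rw [if_pos hs, if_pos hs, hval]
      by_cases h2 : s.val + t < m'
      · rw [if_pos h2, if_pos h2]
      · rw [if_neg h2, if_neg h2, mul_zero]
    · rw [if_neg hs, if_neg hs, zero_mul]
  simp_rw [hkey]
  rw [sum_zmod_val (fun i => if i < m then (if i + t < m' then f i * g (i + t) else 0) else 0),
    ← Finset.sum_filter]
  have hflt : (range L).filter (fun i => i < m) = range m := by
    ext i; simp only [mem_filter, mem_range]; omega
  rw [hflt]

/-- **Backward shifts**: `Σ_s F(s) G(s - z) = Σ_s G(s) F(s + z)` on `ℤ/L`. [folklore] -/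
private theorem sum_mul_sub_eq_sum_mul_add {L : ℕ} [NeZero L] (F G : ZMod L → ℝ) (z : ZMod L) :
    ∑ s : ZMod L, F s * G (s - z) = ∑ s : ZMod L, G s * F (s + z) := by
  rw [← Equiv.sum_comp (Equiv.addRight z) (fun s => F s * G (s - z))]
  simp only [Equiv.coe_addRight, add_sub_cancel_right, mul_comm]

/-- Every residue is a forward shift by its `val`, and a residue with `val > L - m` is minus a shift by
`L - val < m`. [folklore] -/
private theorem zmod_eq_neg_natCast {L : ℕ} [NeZero L] (z : ZMod L) :
    z = -(((L - z.val : ℕ)) : ZMod L) := by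
  have h : (((L - z.val : ℕ)) : ZMod L) = -z := by
    rw [Nat.cast_sub (ZMod.val_lt z).le, ZMod.natCast_self, ZMod.natCast_zmod_val, zero_sub]
  rw [h, neg_neg]

/-- `Σ_{i<m} (if i + t < m' then F i else 0) = Σ_{i < min m (m'-t)} F i`. [folklore] -/
private theorem sum_range_ite_add_lt {M : Type*} [AddCommMonoid M] (F : ℕ → M) (m m' t : ℕ) :
    ∑ i ∈ range m, (if i + t < m' then F i else 0) = ∑ i ∈ range (min m (m' - t)), F i := by
  rw [← Finset.sum_filter]
  congr 1
  ext i
  simp only [mem_filter, mem_range, lt_min_iff]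
  omega

/-- Diagonal correlations: `Σ_s f̂(s) ĝ(s) = Σ_{i<m} f i g i` for supports `[0,m) ⊆ [0,m')`, `m ≤ L`. [folklore] -/
private theorem sum_per_mul_per_self {L : ℕ} [NeZero L] {m m' : ℕ} (hm : m ≤ L) (hmm' : m ≤ m')
    (f g : ℕ → ℝ) :
    ∑ s : ZMod L, (if s.val < m then f s.val else 0) * (if s.val < m' then g s.val else 0) =
      ∑ i ∈ range m, f i * g i := by
  have h := sum_per_mul_per_add (L := L) (m := m) (m' := m') (t := 0) (by simpa using hm) f g
  simp only [Nat.cast_zero, add_zero] at h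
  rw [h]
  refine Finset.sum_congr rfl fun i hi => ?_
  rw [if_pos (by have := mem_range.1 hi; omega)]

/-! ### §4 One-dimensional correlation bounds for the periodised weights

For a sequence `f` supported on `[0,m)` write `f̂(s) = f(s.val)` if `s.val < m` and `0` otherwise (`s : ℤ/L`).  The
pair weights of the two-dimensional argument are products of the correlations `Σ_s f̂(s) ĝ(s+u)`; this section
bounds them for ALL shifts `u : ℤ/L` in terms of the truncated sums over `ℕ` (no wrap-around when `L ≥ m + m'`). -/

/-- **All-shift bound for a periodised correlation.**  If `L ≥ m + m'`, `f, g ≥ 0`, and the truncated forward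
correlations `Σ_{i<m, i+t<m'} f(i) g(i+t)` (`t ≥ 0`) and backward correlations `Σ_{i<m', i+t<m} g(i) f(i+t)`
(`t ≥ 1`) are all `≤ X`, then `Σ_s f̂(s) ĝ(s+u) ≤ X` for every `u : ℤ/L`. [folklore] -/
private theorem sum_per_mul_per_le {L : ℕ} [NeZero L] {m m' : ℕ} (hL : m + m' ≤ L) (f g : ℕ → ℝ) {X : ℝ}
    (hfwd : ∀ t : ℕ, ∑ i ∈ range m, (if i + t < m' then f i * g (i + t) else 0) ≤ X)
    (hbwd : ∀ t : ℕ, 1 ≤ t → t < m → ∑ i ∈ range m', (if i + t < m then g i * f (i + t) else 0) ≤ X)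
    (u : ZMod L) :
    ∑ s : ZMod L, (if s.val < m then f s.val else 0) *
        (if (s + u).val < m' then g (s + u).val else 0) ≤ X := by
  by_cases hu : u.val + m ≤ L
  · -- forward representative `u = u.val`
    have hrep : u = ((u.val : ℕ) : ZMod L) := (ZMod.natCast_zmod_val u).symm
    rw [hrep, sum_per_mul_per_add hu f g]
    exact hfwd u.val
  · -- backward representative `u = -(L - u.val)`, `1 ≤ L - u.val < m`
    push Not at hu
    have hval := ZMod.val_lt u
    set t' : ℕ := L - u.val with ht'
    have ht'1 : 1 ≤ t' := by omega
    have ht'm : t' < m := by omega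
    have hrep : u = -((t' : ℕ) : ZMod L) := zmod_eq_neg_natCast u
    rw [hrep]
    have hswap := sum_mul_sub_eq_sum_mul_add (L := L) (fun s => if s.val < m then f s.val else 0)
      (fun s => if s.val < m' then g s.val else 0) ((t' : ℕ) : ZMod L)
    simp only [sub_eq_add_neg] at hswap
    rw [hswap, sum_per_mul_per_add (by omega : t' + m' ≤ L) g f]
    exact hbwd t' ht'1 ht'm

/-- **All-shift bound for a periodised AUTOcorrelation away from `0, ±1`.**  If `L ≥ 2m`, `f ≥ 0`... more
precisely: if the truncated autocorrelations `Σ_{i<m, i+t<m} f(i) f(i+t)` for `t ≥ 2` are `≤ Q` and the one for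
`t = 1` equals `Q`, then `Σ_s f̂(s) f̂(s+u) ≤ Q` for every `u ≠ 0`. [folklore] -/
private theorem sum_per_mul_per_le_of_ne_zero {L : ℕ} [NeZero L] {m : ℕ} (hL : m + m ≤ L) (f : ℕ → ℝ)
    {Q : ℝ} (hone : ∑ i ∈ range m, (if i + 1 < m then f i * f (i + 1) else 0) = Q)
    (htwo : ∀ t : ℕ, 2 ≤ t → ∑ i ∈ range m, (if i + t < m then f i * f (i + t) else 0) ≤ Q)
    {u : ZMod L} (hu0 : u ≠ 0) :
    ∑ s : ZMod L, (if s.val < m then f s.val else 0) *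
        (if (s + u).val < m then f (s + u).val else 0) ≤ Q := by
  have hval0 : u.val ≠ 0 := fun h => hu0 ((ZMod.val_eq_zero u).1 h)
  have hge : ∀ t : ℕ, 1 ≤ t → ∑ i ∈ range m, (if i + t < m then f i * f (i + t) else 0) ≤ Q := by
    intro t ht
    rcases (show t = 1 ∨ 2 ≤ t by omega) with h1 | h2
    · rw [h1, hone]
    · exact htwo t h2
  by_cases hu : u.val + m ≤ L
  · have hrep : u = ((u.val : ℕ) : ZMod L) := (ZMod.natCast_zmod_val u).symm
    rw [hrep, sum_per_mul_per_add hu f f]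
    exact hge u.val (by omega)
  · push Not at hu
    have hval := ZMod.val_lt u
    set t' : ℕ := L - u.val with ht'
    have hrep : u = -((t' : ℕ) : ZMod L) := zmod_eq_neg_natCast u
    rw [hrep]
    have hswap := sum_mul_sub_eq_sum_mul_add (L := L) (fun s => if s.val < m then f s.val else 0)
      (fun s => if s.val < m then f s.val else 0) ((t' : ℕ) : ZMod L)
    simp only [sub_eq_add_neg] at hswap
    rw [hswap, sum_per_mul_per_add (by omega : t' + m ≤ L) f f]
    exact hge t' (by omega)

/-- Nearest-neighbour autocorrelation `≤` the square sum: `Σ_{i<m, i+1<m} f(i) f(i+1) ≤ Σ_{i<m} f(i)²`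
(`2ab ≤ a² + b²`). [folklore] -/
private theorem sum_mul_succ_le_sum_mul_self (f : ℕ → ℝ) (m : ℕ) :
    ∑ i ∈ range m, (if i + 1 < m then f i * f (i + 1) else 0) ≤ ∑ i ∈ range m, f i * f i := by
  have hA : ∀ i ∈ range m, (if i + 1 < m then f i * f (i + 1) else 0) ≤
      f i * f i / 2 + (if i + 1 < m then f (i + 1) * f (i + 1) / 2 else 0) := by
    intro i _
    split_ifs with h
    · nlinarith [sq_nonneg (f i - f (i + 1))]
    · nlinarith [sq_nonneg (f i)]
  refine (Finset.sum_le_sum hA).trans ?_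
  rw [Finset.sum_add_distrib, sum_range_ite_add_lt, ← Finset.sum_div, ← Finset.sum_div]
  have hB : ∑ i ∈ range (min m (m - 1)), f (i + 1) * f (i + 1) ≤ ∑ i ∈ range m, f i * f i := by
    cases m with
    | zero => simp
    | succ k =>
      rw [show min (k + 1) (k + 1 - 1) = k by omega, Finset.sum_range_succ' (fun i => f i * f i)]
      nlinarith [sq_nonneg (f 0)]
  linarith [hB]

/-! ### §5 Two-dimensional bookkeeping on the torus `(ℤ/L)²`: reindexing and the expansion of `Σ_t W_t²` -/

/-- Product sums over `(ℤ/L)²` factorise. [folklore] -/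
private theorem sum_prod_mul_eq {L : ℕ} [NeZero L] (F G : ZMod L → ℝ) :
    ∑ s : ZMod L × ZMod L, F s.1 * G s.2 = (∑ a : ZMod L, F a) * ∑ b : ZMod L, G b := by
  rw [Fintype.sum_prod_type, Finset.sum_mul_sum]

/-- Translating the summation variable: `Σ_t F(x - t) = Σ_s F(s)`. [folklore] -/
private theorem sum_sub_left {V : Type*} [AddCommGroup V] [Fintype V] {M : Type*} [AddCommMonoid M]
    (F : V → M) (x : V) : ∑ t, F (x - t) = ∑ s, F s :=
  Equiv.sum_comp (Equiv.subLeft x) F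

/-- Translating the summation variable: `Σ_y G(y) = Σ_z G(x + z)`. [folklore] -/
private theorem sum_add_left' {V : Type*} [AddCommGroup V] [Fintype V] {M : Type*} [AddCommMonoid M]
    (G : V → M) (x : V) : ∑ y, G y = ∑ z, G (x + z) :=
  (Equiv.sum_comp (Equiv.addLeft x) G).symm

omit [DecidableEq n] in
/-- **Expansion of the square of the Hamiltonian** `H = Σ_x (P₀(x) + P₁(x))` over ordered pairs, the second
member written relative to the first: `H² = Σ_x Σ_z Σ_{j,k} P_j(x) P_k(x+z)`. [cite: LemmXiang2022, §3.3 (eqn:hsum)] -/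
private theorem sq_expand {V : Type*} [AddCommGroup V] [Fintype V] (P₀ P₁ : V → Matrix n n ℂ) :
    (∑ x, (P₀ x + P₁ x)) * (∑ x, (P₀ x + P₁ x)) =
      ∑ x, ∑ z, (P₀ x * P₀ (x + z) + P₀ x * P₁ (x + z) + P₁ x * P₀ (x + z) + P₁ x * P₁ (x + z)) := by
  rw [Finset.sum_mul_sum]
  refine Finset.sum_congr rfl fun x _ => ?_
  rw [sum_add_left' (fun y => (P₀ x + P₁ x) * (P₀ y + P₁ y)) x]
  refine Finset.sum_congr rfl fun z _ => ?_
  rw [add_mul, mul_add, mul_add]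
  abel

omit [DecidableEq n] in
/-- **Expansion of the auxiliary operator** `A = Σ_t W_t²`, `W_t = Σ_x (w₀(x-t) P₀(x) + w₁(x-t) P₁(x))`, over
ordered pairs with TRANSLATION-SUMMED pair weights `Ω_{jk}(z) = Σ_s w_j(s) w_k(s+z)`:
`A = Σ_x Σ_z Σ_{j,k} Ω_{jk}(z) P_j(x) P_k(x+z)`. [cite: LemmXiang2022, §3.2 (eq:wsum)] -/
private theorem sum_sq_weighted_expand {V : Type*} [AddCommGroup V] [Fintype V]
    (P₀ P₁ : V → Matrix n n ℂ) (w₀ w₁ : V → ℝ) :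
    ∑ t, (∑ x, ((w₀ (x - t) : ℂ) • P₀ x + (w₁ (x - t) : ℂ) • P₁ x)) *
        (∑ x, ((w₀ (x - t) : ℂ) • P₀ x + (w₁ (x - t) : ℂ) • P₁ x)) =
      ∑ x, ∑ z, ((((∑ s, w₀ s * w₀ (s + z) : ℝ)) : ℂ) • (P₀ x * P₀ (x + z)) +
        (((∑ s, w₀ s * w₁ (s + z) : ℝ)) : ℂ) • (P₀ x * P₁ (x + z)) +
        (((∑ s, w₁ s * w₀ (s + z) : ℝ)) : ℂ) • (P₁ x * P₀ (x + z)) +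
        (((∑ s, w₁ s * w₁ (s + z) : ℝ)) : ℂ) • (P₁ x * P₁ (x + z))) := by
  -- step 1: each `W_t²` over ordered pairs `(x, x + z)`
  have h1 : ∀ t, (∑ x, ((w₀ (x - t) : ℂ) • P₀ x + (w₁ (x - t) : ℂ) • P₁ x)) *
      (∑ x, ((w₀ (x - t) : ℂ) • P₀ x + (w₁ (x - t) : ℂ) • P₁ x)) =
      ∑ x, ∑ z, (((w₀ (x - t) : ℂ) * (w₀ (x + z - t) : ℂ)) • (P₀ x * P₀ (x + z)) +
        ((w₀ (x - t) : ℂ) * (w₁ (x + z - t) : ℂ)) • (P₀ x * P₁ (x + z)) +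
        ((w₁ (x - t) : ℂ) * (w₀ (x + z - t) : ℂ)) • (P₁ x * P₀ (x + z)) +
        ((w₁ (x - t) : ℂ) * (w₁ (x + z - t) : ℂ)) • (P₁ x * P₁ (x + z))) := by
    intro t
    rw [Finset.sum_mul_sum]
    refine Finset.sum_congr rfl fun x _ => ?_
    rw [sum_add_left' (fun y => ((w₀ (x - t) : ℂ) • P₀ x + (w₁ (x - t) : ℂ) • P₁ x) *
      ((w₀ (y - t) : ℂ) • P₀ y + (w₁ (y - t) : ℂ) • P₁ y)) x]
    refine Finset.sum_congr rfl fun z _ => ?_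
    simp only [add_mul, mul_add, smul_mul_assoc, mul_smul_comm]
    module
  -- step 2: summed weights `Σ_t w_j(x-t) w_k(x+z-t) = Σ_s w_j(s) w_k(s+z)`
  have h2 : ∀ (u v : V → ℝ) (x z : V),
      ∑ t, ((u (x - t) : ℂ) * (v (x + z - t) : ℂ)) = (((∑ s, u s * v (s + z) : ℝ)) : ℂ) := by
    intro u v x z
    push_cast
    rw [← sum_sub_left (fun s => (u s : ℂ) * (v (s + z) : ℂ)) x]
    refine Finset.sum_congr rfl fun t _ => ?_
    rw [show x + z - t = x - t + z by abel]
  simp_rw [h1]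
  rw [Finset.sum_comm]
  refine Finset.sum_congr rfl fun x _ => ?_
  rw [Finset.sum_comm]
  refine Finset.sum_congr rfl fun z _ => ?_
  simp only [Finset.sum_add_distrib, ← Finset.sum_smul, h2]

/-! ### §6 The Knabe-type comparison `K₃ H² + (K₀ + K₃ - 2K₁) H ≥ A` on the periodic square lattice

Edges of the torus `(ℤ/L)²`: the HORIZONTAL edge at `x` joins `x` and `x + (1,0)` and carries the projection
`P₀ x`; the VERTICAL edge at `x` joins `x` and `x + (0,1)` and carries `P₁ x`.  Two distinct edges share a vertex
exactly in the following relative positions `z = y - x` of the second edge: collinear pairs `(P₀ x, P₀ y)`: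
`z = ±(1,0)`; `(P₁ x, P₁ y)`: `z = ±(0,1)`; corner pairs `(P₀ x, P₁ y)`: `z ∈ {0, (1,0), (0,-1), (1,-1)}`;
`(P₁ x, P₀ y)`: `z ∈ {0, (-1,0), (0,1), (-1,1)}`.  All other pairs commute. -/

omit [DecidableEq n] in
/-- Real part of a weighted pair quadratic form. [folklore] -/
private theorem re_smul_pair (w : ℝ) (M : Matrix n n ℂ) (φ : n → ℂ) :
    (star φ ⬝ᵥ (((w : ℂ) • M) *ᵥ φ)).re = w * (star φ ⬝ᵥ (M *ᵥ φ)).re := by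
  rw [smul_mulVec, dotProduct_smul, smul_eq_mul, Complex.re_ofReal_mul]

omit [DecidableEq n] in
/-- **The Knabe-type comparison on the periodic square lattice, in quadratic form** (Lemm–Xiang §3.2–3.3 for
`D = 2`, for arbitrary — not necessarily translation-invariant — nearest-neighbour projections): if the
translation-summed pair weights `Ω_{jk}(z)` of the auxiliary operator
`A = Σ_x Σ_z Σ_{jk} Ω_{jk}(z) P_j(x) P_k(x+z)` equal `K₀` on the diagonal, `K₁` on collinear pairs sharing a vertex,
`K₃` on corner pairs, and are `≤ K₃` on all other pairs, with `K₁ ≤ K₃`, then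
`K₃ H² + (K₀ + K₃ - 2K₁) H - A ≥ 0` (the collinear anticommutators are absorbed by the operator Cauchy–Schwarz
inequality `{P, Q} ≥ -(P + Q)`, each edge having exactly two collinear neighbours).
[cite: LemmXiang2022, §3.2 (eq:Arewrite), §3.3 (eqn:hsum)–(eqn:fundamentalsum)] -/
private theorem sq_comparison_squareLattice {L : ℕ} [NeZero L] (hL : 3 ≤ L)
    (P₀ P₁ : ZMod L × ZMod L → Matrix n n ℂ) (hh₀ : ∀ x, (P₀ x).IsHermitian)
    (hi₀ : ∀ x, P₀ x * P₀ x = P₀ x) (hh₁ : ∀ x, (P₁ x).IsHermitian) (hi₁ : ∀ x, P₁ x * P₁ x = P₁ x)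
    (hc00 : ∀ x z : ZMod L × ZMod L, z ≠ 0 → z ≠ (1, 0) → z ≠ (-1, 0) →
      P₀ x * P₀ (x + z) = P₀ (x + z) * P₀ x)
    (hc11 : ∀ x z : ZMod L × ZMod L, z ≠ 0 → z ≠ (0, 1) → z ≠ (0, -1) →
      P₁ x * P₁ (x + z) = P₁ (x + z) * P₁ x)
    (hc01 : ∀ x z : ZMod L × ZMod L, z ≠ 0 → z ≠ (1, 0) → z ≠ (0, -1) → z ≠ (1, -1) →
      P₀ x * P₁ (x + z) = P₁ (x + z) * P₀ x)
    (hc10 : ∀ x z : ZMod L × ZMod L, z ≠ 0 → z ≠ (-1, 0) → z ≠ (0, 1) → z ≠ (-1, 1) →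
      P₁ x * P₀ (x + z) = P₀ (x + z) * P₁ x)
    (Ω₀₀ Ω₀₁ Ω₁₀ Ω₁₁ : ZMod L × ZMod L → ℝ) (K₀ K₁ K₃ : ℝ) (hK : K₁ ≤ K₃)
    (h00a : Ω₀₀ 0 = K₀) (h00b : Ω₀₀ (1, 0) = K₁) (h00c : Ω₀₀ (-1, 0) = K₁)
    (h00d : ∀ z, z ≠ 0 → z ≠ (1, 0) → z ≠ (-1, 0) → Ω₀₀ z ≤ K₃)
    (h11a : Ω₁₁ 0 = K₀) (h11b : Ω₁₁ (0, 1) = K₁) (h11c : Ω₁₁ (0, -1) = K₁)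
    (h11d : ∀ z, z ≠ 0 → z ≠ (0, 1) → z ≠ (0, -1) → Ω₁₁ z ≤ K₃)
    (h01a : Ω₀₁ 0 = K₃) (h01b : Ω₀₁ (1, 0) = K₃) (h01c : Ω₀₁ (0, -1) = K₃) (h01d : Ω₀₁ (1, -1) = K₃)
    (h01e : ∀ z, Ω₀₁ z ≤ K₃)
    (h10a : Ω₁₀ 0 = K₃) (h10b : Ω₁₀ (-1, 0) = K₃) (h10c : Ω₁₀ (0, 1) = K₃) (h10d : Ω₁₀ (-1, 1) = K₃)
    (h10e : ∀ z, Ω₁₀ z ≤ K₃)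
    (hAherm : (∑ x : ZMod L × ZMod L, ∑ z : ZMod L × ZMod L,
      ((Ω₀₀ z : ℂ) • (P₀ x * P₀ (x + z)) + (Ω₀₁ z : ℂ) • (P₀ x * P₁ (x + z)) +
        (Ω₁₀ z : ℂ) • (P₁ x * P₀ (x + z)) + (Ω₁₁ z : ℂ) • (P₁ x * P₁ (x + z)))).IsHermitian) :
    ((K₃ : ℂ) • ((∑ x, (P₀ x + P₁ x)) * (∑ x, (P₀ x + P₁ x))) +
      ((K₀ + K₃ - 2 * K₁ : ℝ) : ℂ) • (∑ x, (P₀ x + P₁ x)) -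
      ∑ x : ZMod L × ZMod L, ∑ z : ZMod L × ZMod L,
        ((Ω₀₀ z : ℂ) • (P₀ x * P₀ (x + z)) + (Ω₀₁ z : ℂ) • (P₀ x * P₁ (x + z)) +
          (Ω₁₀ z : ℂ) • (P₁ x * P₀ (x + z)) + (Ω₁₁ z : ℂ) • (P₁ x * P₁ (x + z)))).PosSemidef := by
  classical
  set H : Matrix n n ℂ := ∑ x, (P₀ x + P₁ x) with hHdef
  set A : Matrix n n ℂ := ∑ x : ZMod L × ZMod L, ∑ z : ZMod L × ZMod L,
      ((Ω₀₀ z : ℂ) • (P₀ x * P₀ (x + z)) + (Ω₀₁ z : ℂ) • (P₀ x * P₁ (x + z)) +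
        (Ω₁₀ z : ℂ) • (P₁ x * P₀ (x + z)) + (Ω₁₁ z : ℂ) • (P₁ x * P₁ (x + z))) with hAdef
  set κ : ℝ := K₀ + K₃ - 2 * K₁ with hκ
  -- distinct lattice vectors (`L ≥ 3`)
  have h1ne0 : (1 : ZMod L) ≠ 0 := by
    have h := natCast_ne_natCast_zmod (N := L) (a := 1) (b := 0) (by omega) (by omega) (by omega)
    simpa using h
  have hm1 : (-1 : ZMod L) = ((L - 1 : ℕ) : ZMod L) := by
    rw [Nat.cast_sub (by omega : 1 ≤ L), ZMod.natCast_self, zero_sub, Nat.cast_one]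
  have h1nem1 : (1 : ZMod L) ≠ -1 := by
    rw [hm1]
    have h := natCast_ne_natCast_zmod (N := L) (a := 1) (b := L - 1) (by omega) (by omega) (by omega)
    simpa using h
  have hm1ne0 : (-1 : ZMod L) ≠ 0 := fun h => h1ne0 (neg_eq_zero.1 h)
  have e10_ne0 : ((1, 0) : ZMod L × ZMod L) ≠ 0 := fun h => h1ne0 (congrArg Prod.fst h)
  have em10_ne0 : ((-1, 0) : ZMod L × ZMod L) ≠ 0 := fun h => hm1ne0 (congrArg Prod.fst h)
  have e10_nem10 : ((1, 0) : ZMod L × ZMod L) ≠ (-1, 0) := fun h => h1nem1 (congrArg Prod.fst h)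
  have e01_ne0 : ((0, 1) : ZMod L × ZMod L) ≠ 0 := fun h => h1ne0 (congrArg Prod.snd h)
  have e0m1_ne0 : ((0, -1) : ZMod L × ZMod L) ≠ 0 := fun h => hm1ne0 (congrArg Prod.snd h)
  have e01_ne0m1 : ((0, 1) : ZMod L × ZMod L) ≠ (0, -1) := fun h => h1nem1 (congrArg Prod.snd h)
  -- Hermitian bookkeeping
  have hPpos₀ : ∀ x, (P₀ x).PosSemidef := fun x => posSemidef_of_isHermitian_of_mul_self (hh₀ x) (hi₀ x)
  have hPpos₁ : ∀ x, (P₁ x).PosSemidef := fun x => posSemidef_of_isHermitian_of_mul_self (hh₁ x) (hi₁ x)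
  have hHherm : H.IsHermitian := by
    rw [hHdef]
    exact (posSemidef_sum _ fun x _ => (hPpos₀ x).add (hPpos₁ x)).1
  have hHpos : H.PosSemidef := posSemidef_sum _ fun x _ => (hPpos₀ x).add (hPpos₁ x)
  have hHHherm : (H * H).IsHermitian := by
    rw [IsHermitian, conjTranspose_mul, hHherm.eq]
  have hMherm : ((K₃ : ℂ) • (H * H) + ((κ : ℝ) : ℂ) • H - A).IsHermitian := by
    refine IsHermitian.sub (IsHermitian.add ?_ ?_) hAherm
    · rw [IsHermitian, conjTranspose_smul, hHHherm.eq, Complex.star_def, Complex.conj_ofReal]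
    · rw [IsHermitian, conjTranspose_smul, hHherm.eq, Complex.star_def, Complex.conj_ofReal]
  refine PosSemidef.of_dotProduct_mulVec_nonneg hMherm fun φ => ?_
  rw [dotProduct_mulVec_eq_re_of_isHermitian hMherm, Complex.zero_le_real]
  -- real quantities
  set a₀ : ZMod L × ZMod L → ℝ := fun x => (star φ ⬝ᵥ (P₀ x *ᵥ φ)).re with ha₀
  set a₁ : ZMod L × ZMod L → ℝ := fun x => (star φ ⬝ᵥ (P₁ x *ᵥ φ)).re with ha₁
  set r₀₀ : ZMod L × ZMod L → ZMod L × ZMod L → ℝ := fun x z => (star φ ⬝ᵥ ((P₀ x * P₀ (x + z)) *ᵥ φ)).re with hr₀₀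
  set r₀₁ : ZMod L × ZMod L → ZMod L × ZMod L → ℝ := fun x z => (star φ ⬝ᵥ ((P₀ x * P₁ (x + z)) *ᵥ φ)).re with hr₀₁
  set r₁₀ : ZMod L × ZMod L → ZMod L × ZMod L → ℝ := fun x z => (star φ ⬝ᵥ ((P₁ x * P₀ (x + z)) *ᵥ φ)).re with hr₁₀
  set r₁₁ : ZMod L × ZMod L → ZMod L × ZMod L → ℝ := fun x z => (star φ ⬝ᵥ ((P₁ x * P₁ (x + z)) *ᵥ φ)).re with hr₁₁
  have ha₀0 : ∀ x, 0 ≤ a₀ x := fun x => (Complex.nonneg_iff.1 ((hPpos₀ x).dotProduct_mulVec_nonneg φ)).1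
  have ha₁0 : ∀ x, 0 ≤ a₁ x := fun x => (Complex.nonneg_iff.1 ((hPpos₁ x).dotProduct_mulVec_nonneg φ)).1
  -- the three quadratic forms as real sums
  have hQH : (star φ ⬝ᵥ (H *ᵥ φ)).re = ∑ x, (a₀ x + a₁ x) := by
    rw [hHdef, sum_mulVec, dotProduct_sum, Complex.re_sum]
    refine Finset.sum_congr rfl fun x _ => ?_
    rw [add_mulVec, dotProduct_add, Complex.add_re]
  have hQHH : (star φ ⬝ᵥ ((H * H) *ᵥ φ)).re =
      ∑ x, ∑ z, (r₀₀ x z + r₀₁ x z + r₁₀ x z + r₁₁ x z) := by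
    rw [hHdef, sq_expand, sum_mulVec, dotProduct_sum, Complex.re_sum]
    refine Finset.sum_congr rfl fun x _ => ?_
    rw [sum_mulVec, dotProduct_sum, Complex.re_sum]
    refine Finset.sum_congr rfl fun z _ => ?_
    simp only [add_mulVec, dotProduct_add, Complex.add_re, hr₀₀, hr₀₁, hr₁₀, hr₁₁]
  have hQA : (star φ ⬝ᵥ (A *ᵥ φ)).re =
      ∑ x, ∑ z, (Ω₀₀ z * r₀₀ x z + Ω₀₁ z * r₀₁ x z + Ω₁₀ z * r₁₀ x z + Ω₁₁ z * r₁₁ x z) := by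
    rw [hAdef, sum_mulVec, dotProduct_sum, Complex.re_sum]
    refine Finset.sum_congr rfl fun x _ => ?_
    rw [sum_mulVec, dotProduct_sum, Complex.re_sum]
    refine Finset.sum_congr rfl fun z _ => ?_
    simp only [add_mulVec, dotProduct_add, Complex.add_re, re_smul_pair, hr₀₀, hr₀₁, hr₁₀, hr₁₁]
  have hQM : (star φ ⬝ᵥ (((K₃ : ℂ) • (H * H) + ((κ : ℝ) : ℂ) • H - A) *ᵥ φ)).re =
      K₃ * (star φ ⬝ᵥ ((H * H) *ᵥ φ)).re + κ * (star φ ⬝ᵥ (H *ᵥ φ)).re - (star φ ⬝ᵥ (A *ᵥ φ)).re := by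
    rw [sub_mulVec, add_mulVec, dotProduct_sub, dotProduct_add, Complex.sub_re, Complex.add_re,
      re_smul_pair, re_smul_pair]
  rw [hQM, hQHH, hQA, hQH]
  -- termwise lower bound
  set lb : ZMod L × ZMod L → ZMod L × ZMod L → ℝ := fun x z =>
    ((if z = 0 then (K₃ - K₀) * a₀ x else 0) -
      (if z = (1, 0) then (K₃ - K₁) / 2 * (a₀ x + a₀ (x + (1, 0))) else 0) -
      (if z = (-1, 0) then (K₃ - K₁) / 2 * (a₀ x + a₀ (x + (-1, 0))) else 0)) +
    ((if z = 0 then (K₃ - K₀) * a₁ x else 0) -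
      (if z = (0, 1) then (K₃ - K₁) / 2 * (a₁ x + a₁ (x + (0, 1))) else 0) -
      (if z = (0, -1) then (K₃ - K₁) / 2 * (a₁ x + a₁ (x + (0, -1))) else 0)) with hlb
  -- (i) the lower bound sums to `-κ Σ (a₀ + a₁)`
  have hshift₀ : ∀ e : ZMod L × ZMod L, ∑ x, a₀ (x + e) = ∑ x, a₀ x := fun e =>
    Equiv.sum_comp (Equiv.addRight e) a₀
  have hshift₁ : ∀ e : ZMod L × ZMod L, ∑ x, a₁ (x + e) = ∑ x, a₁ x := fun e =>
    Equiv.sum_comp (Equiv.addRight e) a₁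
  have hlbsum : ∑ x, ∑ z, lb x z = -κ * ∑ x, (a₀ x + a₁ x) := by
    have hz : ∀ x, ∑ z, lb x z =
        ((K₃ - K₀) * a₀ x - (K₃ - K₁) / 2 * (a₀ x + a₀ (x + (1, 0))) -
          (K₃ - K₁) / 2 * (a₀ x + a₀ (x + (-1, 0)))) +
        ((K₃ - K₀) * a₁ x - (K₃ - K₁) / 2 * (a₁ x + a₁ (x + (0, 1))) -
          (K₃ - K₁) / 2 * (a₁ x + a₁ (x + (0, -1)))) := by
      intro x
      simp only [hlb, Finset.sum_add_distrib, Finset.sum_sub_distrib, Finset.sum_ite_eq', Finset.mem_univ,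
        if_true]
    simp_rw [hz]
    simp only [Finset.sum_add_distrib, Finset.sum_sub_distrib, ← Finset.mul_sum, hshift₀, hshift₁]
    rw [hκ]
    ring
  -- (ii) termwise comparison
  have hterm : ∀ x z, lb x z ≤
      (K₃ - Ω₀₀ z) * r₀₀ x z + (K₃ - Ω₀₁ z) * r₀₁ x z + (K₃ - Ω₁₀ z) * r₁₀ x z +
        (K₃ - Ω₁₁ z) * r₁₁ x z := by
    intro x z
    -- the four pair types
    have h00 : (if z = 0 then (K₃ - K₀) * a₀ x else 0) -
        (if z = (1, 0) then (K₃ - K₁) / 2 * (a₀ x + a₀ (x + (1, 0))) else 0) -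
        (if z = (-1, 0) then (K₃ - K₁) / 2 * (a₀ x + a₀ (x + (-1, 0))) else 0) ≤
        (K₃ - Ω₀₀ z) * r₀₀ x z := by
      by_cases hz0 : z = 0
      · subst hz0
        rw [if_pos rfl, if_neg e10_ne0.symm, if_neg em10_ne0.symm, sub_zero, sub_zero, h00a]
        have : r₀₀ x 0 = a₀ x := by simp only [hr₀₀, ha₀, add_zero, hi₀]
        rw [this]
      · rw [if_neg hz0, zero_sub]
        by_cases hzp : z = (1, 0)
        · subst hzp
          rw [if_pos rfl, if_neg e10_nem10, sub_zero, h00b]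
          have h : -(a₀ x + a₀ (x + (1, 0))) ≤ 2 * r₀₀ x (1, 0) :=
            two_mul_re_pair_ge (hh₀ x) (hi₀ x) (hh₀ (x + (1, 0))) (hi₀ (x + (1, 0))) φ
          have h2 := mul_le_mul_of_nonneg_left h (sub_nonneg.2 hK)
          linarith [h2]
        · rw [if_neg hzp, neg_zero, zero_sub]
          by_cases hzm : z = (-1, 0)
          · subst hzm
            rw [if_pos rfl, h00c]
            have h : -(a₀ x + a₀ (x + (-1, 0))) ≤ 2 * r₀₀ x (-1, 0) :=
              two_mul_re_pair_ge (hh₀ x) (hi₀ x) (hh₀ (x + (-1, 0))) (hi₀ (x + (-1, 0))) φ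
            have h2 := mul_le_mul_of_nonneg_left h (sub_nonneg.2 hK)
            linarith [h2]
          · rw [if_neg hzm, neg_zero]
            exact mul_nonneg (sub_nonneg.2 (h00d z hz0 hzp hzm))
              (re_pair_nonneg_of_commute (hh₀ x) (hi₀ x) (hh₀ _) (hi₀ _) (hc00 x z hz0 hzp hzm) φ)
    have h11 : (if z = 0 then (K₃ - K₀) * a₁ x else 0) -
        (if z = (0, 1) then (K₃ - K₁) / 2 * (a₁ x + a₁ (x + (0, 1))) else 0) -
        (if z = (0, -1) then (K₃ - K₁) / 2 * (a₁ x + a₁ (x + (0, -1))) else 0) ≤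
        (K₃ - Ω₁₁ z) * r₁₁ x z := by
      by_cases hz0 : z = 0
      · subst hz0
        rw [if_pos rfl, if_neg e01_ne0.symm, if_neg e0m1_ne0.symm, sub_zero, sub_zero, h11a]
        have : r₁₁ x 0 = a₁ x := by simp only [hr₁₁, ha₁, add_zero, hi₁]
        rw [this]
      · rw [if_neg hz0, zero_sub]
        by_cases hzp : z = (0, 1)
        · subst hzp
          rw [if_pos rfl, if_neg e01_ne0m1, sub_zero, h11b]
          have h : -(a₁ x + a₁ (x + (0, 1))) ≤ 2 * r₁₁ x (0, 1) :=
            two_mul_re_pair_ge (hh₁ x) (hi₁ x) (hh₁ (x + (0, 1))) (hi₁ (x + (0, 1))) φ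
          have h2 := mul_le_mul_of_nonneg_left h (sub_nonneg.2 hK)
          linarith [h2]
        · rw [if_neg hzp, neg_zero, zero_sub]
          by_cases hzm : z = (0, -1)
          · subst hzm
            rw [if_pos rfl, h11c]
            have h : -(a₁ x + a₁ (x + (0, -1))) ≤ 2 * r₁₁ x (0, -1) :=
              two_mul_re_pair_ge (hh₁ x) (hi₁ x) (hh₁ (x + (0, -1))) (hi₁ (x + (0, -1))) φ
            have h2 := mul_le_mul_of_nonneg_left h (sub_nonneg.2 hK)
            linarith [h2]
          · rw [if_neg hzm, neg_zero]
            exact mul_nonneg (sub_nonneg.2 (h11d z hz0 hzp hzm))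
              (re_pair_nonneg_of_commute (hh₁ x) (hi₁ x) (hh₁ _) (hi₁ _) (hc11 x z hz0 hzp hzm) φ)
    have h01 : 0 ≤ (K₃ - Ω₀₁ z) * r₀₁ x z := by
      by_cases ht : z = 0 ∨ z = (1, 0) ∨ z = (0, -1) ∨ z = (1, -1)
      · have hΩ : Ω₀₁ z = K₃ := by
          rcases ht with h | h | h | h <;> rw [h] <;> assumption
        rw [hΩ, sub_self, zero_mul]
      · push Not at ht
        obtain ⟨h1, h2, h3, h4⟩ := ht
        exact mul_nonneg (sub_nonneg.2 (h01e z))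
          (re_pair_nonneg_of_commute (hh₀ x) (hi₀ x) (hh₁ _) (hi₁ _) (hc01 x z h1 h2 h3 h4) φ)
    have h10 : 0 ≤ (K₃ - Ω₁₀ z) * r₁₀ x z := by
      by_cases ht : z = 0 ∨ z = (-1, 0) ∨ z = (0, 1) ∨ z = (-1, 1)
      · have hΩ : Ω₁₀ z = K₃ := by
          rcases ht with h | h | h | h <;> rw [h] <;> assumption
        rw [hΩ, sub_self, zero_mul]
      · push Not at ht
        obtain ⟨h1, h2, h3, h4⟩ := ht
        exact mul_nonneg (sub_nonneg.2 (h10e z))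
          (re_pair_nonneg_of_commute (hh₁ x) (hi₁ x) (hh₀ _) (hi₀ _) (hc10 x z h1 h2 h3 h4) φ)
    rw [hlb]
    linarith [h00, h11, h01, h10]
  -- (iii) assemble
  have hsum : ∑ x, ∑ z, lb x z ≤ ∑ x, ∑ z, ((K₃ - Ω₀₀ z) * r₀₀ x z + (K₃ - Ω₀₁ z) * r₀₁ x z +
      (K₃ - Ω₁₀ z) * r₁₀ x z + (K₃ - Ω₁₁ z) * r₁₁ x z) :=
    Finset.sum_le_sum fun x _ => Finset.sum_le_sum fun z _ => hterm x z
  have hrw : K₃ * ∑ x, ∑ z, (r₀₀ x z + r₀₁ x z + r₁₀ x z + r₁₁ x z) +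
      κ * ∑ x, (a₀ x + a₁ x) -
      ∑ x, ∑ z, (Ω₀₀ z * r₀₀ x z + Ω₀₁ z * r₀₁ x z + Ω₁₀ z * r₁₀ x z + Ω₁₁ z * r₁₁ x z) =
      ∑ x, ∑ z, ((K₃ - Ω₀₀ z) * r₀₀ x z + (K₃ - Ω₀₁ z) * r₀₁ x z +
        (K₃ - Ω₁₀ z) * r₁₀ x z + (K₃ - Ω₁₁ z) * r₁₁ x z) + κ * ∑ x, (a₀ x + a₁ x) := by
    rw [Finset.mul_sum]
    have : ∀ x, K₃ * ∑ z, (r₀₀ x z + r₀₁ x z + r₁₀ x z + r₁₁ x z) -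
        ∑ z, (Ω₀₀ z * r₀₀ x z + Ω₀₁ z * r₀₁ x z + Ω₁₀ z * r₁₀ x z + Ω₁₁ z * r₁₁ x z) =
        ∑ z, ((K₃ - Ω₀₀ z) * r₀₀ x z + (K₃ - Ω₀₁ z) * r₀₁ x z +
          (K₃ - Ω₁₀ z) * r₁₀ x z + (K₃ - Ω₁₁ z) * r₁₁ x z) := by
      intro x
      rw [Finset.mul_sum, ← Finset.sum_sub_distrib]
      refine Finset.sum_congr rfl fun z _ => ?_
      ring
    have hx : ∑ x, (K₃ * ∑ z, (r₀₀ x z + r₀₁ x z + r₁₀ x z + r₁₁ x z)) -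
        ∑ x, ∑ z, (Ω₀₀ z * r₀₀ x z + Ω₀₁ z * r₀₁ x z + Ω₁₀ z * r₁₀ x z + Ω₁₁ z * r₁₁ x z) =
        ∑ x, ∑ z, ((K₃ - Ω₀₀ z) * r₀₀ x z + (K₃ - Ω₀₁ z) * r₀₁ x z +
          (K₃ - Ω₁₀ z) * r₁₀ x z + (K₃ - Ω₁₁ z) * r₁₁ x z) := by
      rw [← Finset.sum_sub_distrib]
      exact Finset.sum_congr rfl fun x _ => this x
    linarith [hx]
  rw [hrw]
  linarith [hsum, hlbsum]

/-! ### §7 The finite-size criterion on the periodic square lattice (general product weights) -/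

/-- Indicator-restricted sums over `ℤ/L`, vector-valued: `Σ_s [s.val < m] F(s) = Σ_{i<m} F(i)`. [folklore] -/
private theorem sum_ite_val_lt {L : ℕ} [NeZero L] {M : Type*} [AddCommMonoid M] {m : ℕ} (hm : m ≤ L)
    (F : ZMod L → M) : ∑ s : ZMod L, (if s.val < m then F s else 0) = ∑ i ∈ range m, F (i : ZMod L) := by
  have h := sum_zmod_val (L := L) (fun i => if i < m then F ((i : ℕ) : ZMod L) else 0)
  simp only [ZMod.natCast_zmod_val] at h
  rw [h, ← Finset.sum_filter]
  congr 1
  ext i; simp only [mem_filter, mem_range]; omega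

omit [DecidableEq n] in
/-- For an orthogonal projection, `⟨v, Pv⟩ = 0` forces `Pv = 0`. [folklore] -/
private theorem mulVec_eq_zero_of_dotProduct_eq_zero {P : Matrix n n ℂ} (hP : P.IsHermitian)
    (hPP : P * P = P) {v : n → ℂ} (h : star v ⬝ᵥ (P *ᵥ v) = 0) : P *ᵥ v = 0 := by
  have h2 : star (P *ᵥ v) ⬝ᵥ (P *ᵥ v) = 0 := by
    rw [← dotProduct_mulVec_mul_self' hP, hPP]; exact h
  exact dotProduct_star_self_eq_zero.1 h2

omit [Fintype n] [DecidableEq n] in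
/-- **Box sums as indicator-weighted lattice sums**: `Σ_{a<m} Σ_{b<m'} P(t + (a,b)) = Σ_x χ(x - t) P(x)` with
`χ(v) = [v₁.val < m][v₂.val < m']` (`m, m' ≤ L`). [folklore] -/
private theorem box_sum_eq_indicator_sum {L : ℕ} [NeZero L] (P : ZMod L × ZMod L → Matrix n n ℂ)
    {m m' : ℕ} (hm : m ≤ L) (hm' : m' ≤ L) (t : ZMod L × ZMod L) :
    ∑ x : ZMod L × ZMod L, ((((if (x - t).1.val < m then (1 : ℝ) else 0) *
        (if (x - t).2.val < m' then (1 : ℝ) else 0) : ℝ)) : ℂ) • P x =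
      ∑ a ∈ range m, ∑ b ∈ range m', P (t + ((a : ZMod L), (b : ZMod L))) := by
  rw [sum_add_left' (fun x : ZMod L × ZMod L => ((((if (x - t).1.val < m then (1 : ℝ) else 0) *
        (if (x - t).2.val < m' then (1 : ℝ) else 0) : ℝ)) : ℂ) • P x) t]
  simp only [add_sub_cancel_left]
  rw [Fintype.sum_prod_type]
  have hsmul : ∀ a b : ZMod L, ((((if a.val < m then (1 : ℝ) else 0) *
      (if b.val < m' then (1 : ℝ) else 0) : ℝ)) : ℂ) • P (t + (a, b)) =
      if a.val < m then (if b.val < m' then P (t + (a, b)) else 0) else 0 := by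
    intro a b
    split_ifs <;> simp
  simp_rw [hsmul]
  have hinner : ∀ a : ZMod L, ∑ b : ZMod L,
      (if a.val < m then (if b.val < m' then P (t + (a, b)) else 0) else 0) =
      if a.val < m then ∑ b ∈ range m', P (t + (a, (b : ZMod L))) else 0 := by
    intro a
    split_ifs with ha
    · exact sum_ite_val_lt hm' _
    · simp
  simp_rw [hinner]
  rw [sum_ite_val_lt hm]

omit [DecidableEq n] in
/-- Kernel of a box Hamiltonian: if `Σ_{a<m} Σ_{b<m'} P(t+(a,b))` (orthogonal projections) annihilates `v`, then so
does every `P(t+(a,b))`. [folklore] -/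
private theorem mulVec_eq_zero_of_box_sum {L : ℕ} [NeZero L] (P : ZMod L × ZMod L → Matrix n n ℂ)
    (hh : ∀ x, (P x).IsHermitian) (hi : ∀ x, P x * P x = P x) {m m' : ℕ} (t : ZMod L × ZMod L)
    {v : n → ℂ}
    (h0 : star v ⬝ᵥ ((∑ a ∈ range m, ∑ b ∈ range m', P (t + ((a : ZMod L), (b : ZMod L)))) *ᵥ v) = 0)
    {a b : ℕ} (ha : a < m) (hb : b < m') : P (t + ((a : ZMod L), (b : ZMod L))) *ᵥ v = 0 := by
  have hnn : ∀ a ∈ range m, 0 ≤ ∑ b ∈ range m', star v ⬝ᵥ (P (t + ((a : ZMod L), (b : ZMod L))) *ᵥ v) :=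
    fun a _ => Finset.sum_nonneg fun b _ =>
      (posSemidef_of_isHermitian_of_mul_self (hh _) (hi _)).dotProduct_mulVec_nonneg v
  rw [sum_mulVec, dotProduct_sum] at h0
  simp_rw [sum_mulVec, dotProduct_sum] at h0
  have ha0 := (Finset.sum_eq_zero_iff_of_nonneg hnn).1 h0 a (mem_range.2 ha)
  have hnn' : ∀ b ∈ range m', 0 ≤ star v ⬝ᵥ (P (t + ((a : ZMod L), (b : ZMod L))) *ᵥ v) :=
    fun b _ => (posSemidef_of_isHermitian_of_mul_self (hh _) (hi _)).dotProduct_mulVec_nonneg v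
  have hb0 := (Finset.sum_eq_zero_iff_of_nonneg hnn').1 ha0 b (mem_range.2 hb)
  exact mulVec_eq_zero_of_dotProduct_eq_zero (hh _) (hi _) hb0

/-- **Finite-size criterion for frustration-free nearest-neighbour systems on the periodic square lattice
(general product weights; Lemm–Xiang's Proposition 3.1 for `D = 2`, WITHOUT translation invariance).**

Setting: the torus `(ℤ/L)²`; orthogonal projections `P₀ x` on the horizontal edges `(x, x + (1,0))` and `P₁ x` on the
vertical edges `(x, x + (0,1))`, projections on edges WITHOUT a common vertex commuting (hypotheses `hc00`, `hc11`,
`hc01`, `hc10`, listing the excluded relative positions); `H = Σ_x (P₀ x + P₁ x)`.  LOCAL GAP: every open box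
`B_t = t + ([0,ℓ] ∩ ℤ)²` — `ℓ(ℓ+1)` horizontal and `(ℓ+1)ℓ` vertical edges — has `H_{B_t}² ≥ ε H_{B_t}` (`hloc`;
for a frustration-free system this says that the gap of `H_{B_t}` is `≥ ε`).  WEIGHTS (eq. (WBgrid), `D = 2`):
`w_{x,e₁} = c_{x₁} d_{x₂}`, `w_{x,e₂} = d_{x₁} c_{x₂}` with `c` supported on `[0,ℓ)`, `d` on `[0,ℓ]`, non-negative,
satisfying the correlation conditions below (they hold for positive weights symmetric about and increasing up to
the midpoint, requirements (i)–(iii) of the source; here they are hypotheses, verified for concrete weights in the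
corollaries), and the effective constants `K₀ = (Σc²)(Σd²)`, `K₁ = (Σ_{i<ℓ-1} c_i c_{i+1})(Σd²)`,
`K₂ = (Σc²)(Σ_{i<ℓ} d_i d_{i+1})`, `K₃ = (Σ_{i<ℓ} c_i d_i)²`, `K₄ = (Σc)²(Σd)²/(ℓ(ℓ+1))`, `K₁, K₂ ≤ K₃`.
CONCLUSION: `H² - (K₄/K₃)(ε - (K₀ + K₃ - 2K₁)/K₄) H ≥ 0`, i.e. "`γ_L^per ≥ (K₄/K₃)(γ_ℓ - (K₀+K₃-2K₁)/K₄)`".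
The source assumes translation-invariant interactions and uses a translation-invariant excited state (Lemma 3);
here that step is the summed spectral Cauchy–Schwarz inequality `family_sum_sq_sub_smul_posSemidef`, so the
interactions `P₀ x`, `P₁ x` are arbitrary (cf. the source's remark that "the proof also applies if the assumptions
of rotation- and/or translation-invariance on the interaction are removed").  `L ≥ 2ℓ + 2`.
[cite: LemmXiang2022, §3.1 Prop. 3.1 (prop:keygrid) with (eq:WBgrid), (K0)–(K4), §3.2–3.5]
[cite: GossetMozgunov2016, §3 Thm. 5 (the square-lattice predecessor, threshold `8/n²`)] -/
theorem squareLattice_sq_sub_smul_posSemidef {L : ℕ} [NeZero L] {ℓ : ℕ} (hℓ : 1 ≤ ℓ) (hL : 2 * ℓ + 2 ≤ L)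
    (P₀ P₁ : ZMod L × ZMod L → Matrix n n ℂ) (hh₀ : ∀ x, (P₀ x).IsHermitian)
    (hi₀ : ∀ x, P₀ x * P₀ x = P₀ x) (hh₁ : ∀ x, (P₁ x).IsHermitian) (hi₁ : ∀ x, P₁ x * P₁ x = P₁ x)
    (hc00 : ∀ x z : ZMod L × ZMod L, z ≠ 0 → z ≠ (1, 0) → z ≠ (-1, 0) →
      P₀ x * P₀ (x + z) = P₀ (x + z) * P₀ x)
    (hc11 : ∀ x z : ZMod L × ZMod L, z ≠ 0 → z ≠ (0, 1) → z ≠ (0, -1) →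
      P₁ x * P₁ (x + z) = P₁ (x + z) * P₁ x)
    (hc01 : ∀ x z : ZMod L × ZMod L, z ≠ 0 → z ≠ (1, 0) → z ≠ (0, -1) → z ≠ (1, -1) →
      P₀ x * P₁ (x + z) = P₁ (x + z) * P₀ x)
    (hc10 : ∀ x z : ZMod L × ZMod L, z ≠ 0 → z ≠ (-1, 0) → z ≠ (0, 1) → z ≠ (-1, 1) →
      P₁ x * P₀ (x + z) = P₀ (x + z) * P₁ x)
    {ε : ℝ} (hε : 0 < ε)
    (hloc : ∀ t : ZMod L × ZMod L,
      (((∑ a ∈ range ℓ, ∑ b ∈ range (ℓ + 1), P₀ (t + ((a : ZMod L), (b : ZMod L)))) +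
          ∑ a ∈ range (ℓ + 1), ∑ b ∈ range ℓ, P₁ (t + ((a : ZMod L), (b : ZMod L)))) *
        ((∑ a ∈ range ℓ, ∑ b ∈ range (ℓ + 1), P₀ (t + ((a : ZMod L), (b : ZMod L)))) +
          ∑ a ∈ range (ℓ + 1), ∑ b ∈ range ℓ, P₁ (t + ((a : ZMod L), (b : ZMod L)))) -
        (ε : ℂ) • ((∑ a ∈ range ℓ, ∑ b ∈ range (ℓ + 1), P₀ (t + ((a : ZMod L), (b : ZMod L)))) +
          ∑ a ∈ range (ℓ + 1), ∑ b ∈ range ℓ, P₁ (t + ((a : ZMod L), (b : ZMod L))))).PosSemidef)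
    (c d : ℕ → ℝ) (hc0 : ∀ i, i < ℓ → 0 ≤ c i) (hd0 : ∀ i, i < ℓ + 1 → 0 ≤ d i)
    (hcc : ∀ t : ℕ, 2 ≤ t → ∑ i ∈ range ℓ, (if i + t < ℓ then c i * c (i + t) else 0) ≤
      ∑ i ∈ range (ℓ - 1), c i * c (i + 1))
    (hdd : ∀ t : ℕ, 2 ≤ t → ∑ i ∈ range (ℓ + 1), (if i + t < ℓ + 1 then d i * d (i + t) else 0) ≤
      ∑ i ∈ range ℓ, d i * d (i + 1))
    (hcd : ∀ t : ℕ, ∑ i ∈ range ℓ, (if i + t < ℓ + 1 then c i * d (i + t) else 0) ≤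
      ∑ i ∈ range ℓ, c i * d i)
    (hdc : ∀ t : ℕ, ∑ i ∈ range (ℓ + 1), (if i + t < ℓ then d i * c (i + t) else 0) ≤
      ∑ i ∈ range ℓ, c i * d i)
    (hX1 : ∑ i ∈ range ℓ, c i * d (i + 1) = ∑ i ∈ range ℓ, c i * d i)
    (K₀ K₁ K₂ K₃ K₄ : ℝ)
    (hK₀ : K₀ = (∑ i ∈ range ℓ, c i * c i) * ∑ i ∈ range (ℓ + 1), d i * d i)
    (hK₁ : K₁ = (∑ i ∈ range (ℓ - 1), c i * c (i + 1)) * ∑ i ∈ range (ℓ + 1), d i * d i)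
    (hK₂ : K₂ = (∑ i ∈ range ℓ, c i * c i) * ∑ i ∈ range ℓ, d i * d (i + 1))
    (hK₃ : K₃ = (∑ i ∈ range ℓ, c i * d i) ^ 2)
    (hK₄ : K₄ = (∑ i ∈ range ℓ, c i) ^ 2 * (∑ i ∈ range (ℓ + 1), d i) ^ 2 / ((ℓ : ℝ) * (ℓ + 1)))
    (hK13 : K₁ ≤ K₃) (hK23 : K₂ ≤ K₃) (hK3 : 0 < K₃) (hK4 : 0 < K₄) :
    ((∑ x, (P₀ x + P₁ x)) * (∑ x, (P₀ x + P₁ x)) -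
      ((K₄ / K₃ * (ε - (K₀ + K₃ - 2 * K₁) / K₄) : ℝ) : ℂ) • ∑ x, (P₀ x + P₁ x)).PosSemidef := by
  classical
  have hℓL : ℓ ≤ L := by omega
  have hℓL' : ℓ + 1 ≤ L := by omega
  have hL3 : 3 ≤ L := by omega
  -- periodised weights and indicators
  set pc : ZMod L → ℝ := fun z => if z.val < ℓ then c z.val else 0 with hpc
  set pd : ZMod L → ℝ := fun z => if z.val < ℓ + 1 then d z.val else 0 with hpd
  set χc : ZMod L → ℝ := fun z => if z.val < ℓ then (fun _ => (1 : ℝ)) z.val else 0 with hχc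
  set χd : ZMod L → ℝ := fun z => if z.val < ℓ + 1 then (fun _ => (1 : ℝ)) z.val else 0 with hχd
  set w₀ : ZMod L × ZMod L → ℝ := fun v => pc v.1 * pd v.2 with hw₀
  set w₁ : ZMod L × ZMod L → ℝ := fun v => pd v.1 * pc v.2 with hw₁
  set u₀ : ZMod L × ZMod L → ℝ := fun v => χc v.1 * χd v.2 with hu₀
  set u₁ : ZMod L × ZMod L → ℝ := fun v => χd v.1 * χc v.2 with hu₁
  set H : Matrix n n ℂ := ∑ x, (P₀ x + P₁ x) with hHdef
  set W : ZMod L × ZMod L → Matrix n n ℂ :=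
    fun t => ∑ x, ((w₀ (x - t) : ℂ) • P₀ x + (w₁ (x - t) : ℂ) • P₁ x) with hW
  set HBi : ZMod L × ZMod L → Matrix n n ℂ :=
    fun t => ∑ x, ((u₀ (x - t) : ℂ) • P₀ x + (u₁ (x - t) : ℂ) • P₁ x) with hHBi
  have hPpos₀ : ∀ x, (P₀ x).PosSemidef := fun x => posSemidef_of_isHermitian_of_mul_self (hh₀ x) (hi₀ x)
  have hPpos₁ : ∀ x, (P₁ x).PosSemidef := fun x => posSemidef_of_isHermitian_of_mul_self (hh₁ x) (hi₁ x)
  have hHpos : H.PosSemidef := posSemidef_sum _ fun x _ => (hPpos₀ x).add (hPpos₁ x)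
  -- abbreviations for the one-dimensional sums
  set S1c : ℝ := ∑ i ∈ range ℓ, c i with hS1c
  set S1d : ℝ := ∑ i ∈ range (ℓ + 1), d i with hS1d
  set S2c : ℝ := ∑ i ∈ range ℓ, c i * c i with hS2c
  set S2d : ℝ := ∑ i ∈ range (ℓ + 1), d i * d i with hS2d
  set Q1c : ℝ := ∑ i ∈ range (ℓ - 1), c i * c (i + 1) with hQ1c
  set Q1d : ℝ := ∑ i ∈ range ℓ, d i * d (i + 1) with hQ1d
  set X : ℝ := ∑ i ∈ range ℓ, c i * d i with hX
  ------------------------------------------------------------------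
  -- (a) the box Hamiltonians in indicator form
  ------------------------------------------------------------------
  have hHB : ∀ t, HBi t = (∑ a ∈ range ℓ, ∑ b ∈ range (ℓ + 1), P₀ (t + ((a : ZMod L), (b : ZMod L)))) +
      ∑ a ∈ range (ℓ + 1), ∑ b ∈ range ℓ, P₁ (t + ((a : ZMod L), (b : ZMod L))) := by
    intro t
    rw [hHBi]
    simp only [Finset.sum_add_distrib]
    rw [box_sum_eq_indicator_sum P₀ hℓL hℓL' t, box_sum_eq_indicator_sum P₁ hℓL' hℓL t]
  ------------------------------------------------------------------
  -- (b) the summed spectral Cauchy–Schwarz inequality: `Σ_t W_t² ≥ ε K₄ H`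
  ------------------------------------------------------------------
  have hχc_sum : ∑ s : ZMod L, χc s = ℓ := by
    rw [hχc, sum_ite_val_lt hℓL, sum_const, card_range, nsmul_eq_mul, mul_one]
  have hχd_sum : ∑ s : ZMod L, χd s = ℓ + 1 := by
    rw [hχd, sum_ite_val_lt hℓL', sum_const, card_range, nsmul_eq_mul, mul_one]
    push_cast; ring
  have hpc_sum : ∑ s : ZMod L, pc s = S1c := by rw [hpc, sum_per hℓL]
  have hpd_sum : ∑ s : ZMod L, pd s = S1d := by rw [hpd, sum_per hℓL']
  have hu₀_sum : ∀ x, ∑ t, u₀ (x - t) = (ℓ : ℝ) * (ℓ + 1) := by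
    intro x
    rw [sum_sub_left u₀ x, hu₀, sum_prod_mul_eq, hχc_sum, hχd_sum]
  have hu₁_sum : ∀ x, ∑ t, u₁ (x - t) = (ℓ : ℝ) * (ℓ + 1) := by
    intro x
    rw [sum_sub_left u₁ x, hu₁, sum_prod_mul_eq, hχc_sum, hχd_sum]; ring
  have hw₀_sum : ∀ x, ∑ t, w₀ (x - t) = S1c * S1d := by
    intro x
    rw [sum_sub_left w₀ x, hw₀, sum_prod_mul_eq, hpc_sum, hpd_sum]
  have hw₁_sum : ∀ x, ∑ t, w₁ (x - t) = S1c * S1d := by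
    intro x
    rw [sum_sub_left w₁ x, hw₁, sum_prod_mul_eq, hpc_sum, hpd_sum]; ring
  have hsumA : ∑ t, HBi t = (((ℓ : ℝ) * (ℓ + 1) : ℝ) : ℂ) • H := by
    rw [hHBi, Finset.sum_comm, hHdef, Finset.smul_sum]
    refine Finset.sum_congr rfl fun x _ => ?_
    rw [Finset.sum_add_distrib, ← Finset.sum_smul, ← Finset.sum_smul, smul_add]
    congr 1
    · congr 1
      rw [← Complex.ofReal_sum, hu₀_sum]
    · congr 1
      rw [← Complex.ofReal_sum, hu₁_sum]
  have hsumB : ∑ t, W t = ((S1c * S1d : ℝ) : ℂ) • H := by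
    rw [hW, Finset.sum_comm, hHdef, Finset.smul_sum]
    refine Finset.sum_congr rfl fun x _ => ?_
    rw [Finset.sum_add_distrib, ← Finset.sum_smul, ← Finset.sum_smul, smul_add]
    congr 1
    · congr 1
      rw [← Complex.ofReal_sum, hw₀_sum]
    · congr 1
      rw [← Complex.ofReal_sum, hw₁_sum]
  have hApos : ∀ t, (HBi t).PosSemidef := by
    intro t
    rw [hHB t]
    exact (posSemidef_sum _ fun a _ => posSemidef_sum _ fun b _ => hPpos₀ _).add
      (posSemidef_sum _ fun a _ => posSemidef_sum _ fun b _ => hPpos₁ _)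
  have hpc0 : ∀ z, 0 ≤ pc z := by
    intro z; simp only [hpc]; split_ifs with h; exacts [hc0 _ h, le_rfl]
  have hpd0 : ∀ z, 0 ≤ pd z := by
    intro z; simp only [hpd]; split_ifs with h; exacts [hd0 _ h, le_rfl]
  have hw₀0 : ∀ v, 0 ≤ w₀ v := fun v => mul_nonneg (hpc0 _) (hpd0 _)
  have hw₁0 : ∀ v, 0 ≤ w₁ v := fun v => mul_nonneg (hpd0 _) (hpc0 _)
  have hBherm : ∀ t, (W t).IsHermitian := by
    intro t
    rw [hW]
    exact (posSemidef_sum _ fun x _ =>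
      ((hPpos₀ x).smul (Complex.zero_le_real.2 (hw₀0 _))).add
        ((hPpos₁ x).smul (Complex.zero_le_real.2 (hw₁0 _)))).1
  have hgap : ∀ t, (HBi t * HBi t - (ε : ℂ) • HBi t).PosSemidef := by
    intro t
    rw [hHB t]
    exact hloc t
  have hker : ∀ t (v : n → ℂ), HBi t *ᵥ v = 0 → W t *ᵥ v = 0 := by
    intro t v hv
    have h0 : star v ⬝ᵥ (HBi t *ᵥ v) = 0 := by rw [hv, dotProduct_zero]
    rw [hHB t, add_mulVec, dotProduct_add] at h0
    -- both box quadratic forms vanish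
    have hnn0 : 0 ≤ star v ⬝ᵥ ((∑ a ∈ range ℓ, ∑ b ∈ range (ℓ + 1),
        P₀ (t + ((a : ZMod L), (b : ZMod L)))) *ᵥ v) :=
      (posSemidef_sum _ fun a _ => posSemidef_sum _ fun b _ => hPpos₀ _).dotProduct_mulVec_nonneg v
    have hnn1 : 0 ≤ star v ⬝ᵥ ((∑ a ∈ range (ℓ + 1), ∑ b ∈ range ℓ,
        P₁ (t + ((a : ZMod L), (b : ZMod L)))) *ᵥ v) :=
      (posSemidef_sum _ fun a _ => posSemidef_sum _ fun b _ => hPpos₁ _).dotProduct_mulVec_nonneg v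
    have h00 : star v ⬝ᵥ ((∑ a ∈ range ℓ, ∑ b ∈ range (ℓ + 1),
        P₀ (t + ((a : ZMod L), (b : ZMod L)))) *ᵥ v) = 0 := by
      apply le_antisymm _ hnn0
      rw [← h0]; exact le_add_of_nonneg_right hnn1
    have h11 : star v ⬝ᵥ ((∑ a ∈ range (ℓ + 1), ∑ b ∈ range ℓ,
        P₁ (t + ((a : ZMod L), (b : ZMod L)))) *ᵥ v) = 0 := by
      apply le_antisymm _ hnn1
      rw [← h0]; exact le_add_of_nonneg_left hnn0
    rw [hW]
    simp only [sum_mulVec, add_mulVec, smul_mulVec]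
    refine Finset.sum_eq_zero fun x _ => ?_
    -- either the weight vanishes or `x` lies in the box
    have hx : x = t + ((((x - t).1.val : ℕ) : ZMod L), (((x - t).2.val : ℕ) : ZMod L)) := by
      rw [ZMod.natCast_zmod_val, ZMod.natCast_zmod_val, Prod.mk.eta, add_sub_cancel]
    have hP0 : (w₀ (x - t) : ℂ) • (P₀ x *ᵥ v) = 0 := by
      by_cases h1 : (x - t).1.val < ℓ
      · by_cases h2 : (x - t).2.val < ℓ + 1
        · rw [hx, mulVec_eq_zero_of_box_sum P₀ hh₀ hi₀ t h00 h1 h2, smul_zero]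
        · have : w₀ (x - t) = 0 := by simp only [hw₀, hpd, if_neg h2, mul_zero]
          rw [this, Complex.ofReal_zero, zero_smul]
      · have : w₀ (x - t) = 0 := by simp only [hw₀, hpc, if_neg h1, zero_mul]
        rw [this, Complex.ofReal_zero, zero_smul]
    have hP1 : (w₁ (x - t) : ℂ) • (P₁ x *ᵥ v) = 0 := by
      by_cases h1 : (x - t).1.val < ℓ + 1
      · by_cases h2 : (x - t).2.val < ℓ
        · rw [hx, mulVec_eq_zero_of_box_sum P₁ hh₁ hi₁ t h11 h1 h2, smul_zero]
        · have : w₁ (x - t) = 0 := by simp only [hw₁, hpc, if_neg h2, mul_zero]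
          rw [this, Complex.ofReal_zero, zero_smul]
      · have : w₁ (x - t) = 0 := by simp only [hw₁, hpd, if_neg h1, zero_mul]
        rw [this, Complex.ofReal_zero, zero_smul]
    rw [hP0, hP1, add_zero]
  have hκA : (0 : ℝ) < (ℓ : ℝ) * (ℓ + 1) := by positivity
  have hfam := family_sum_sq_sub_smul_posSemidef hHpos HBi W hApos hBherm hε hgap hker hκA hsumA hsumB
  ------------------------------------------------------------------
  -- (c) expansion of `A = Σ_t W_t²` over ordered pairs
  ------------------------------------------------------------------
  have hexpW : ∑ t, W t * W t =
      ∑ x, ∑ z, ((((∑ s, w₀ s * w₀ (s + z) : ℝ)) : ℂ) • (P₀ x * P₀ (x + z)) +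
        (((∑ s, w₀ s * w₁ (s + z) : ℝ)) : ℂ) • (P₀ x * P₁ (x + z)) +
        (((∑ s, w₁ s * w₀ (s + z) : ℝ)) : ℂ) • (P₁ x * P₀ (x + z)) +
        (((∑ s, w₁ s * w₁ (s + z) : ℝ)) : ℂ) • (P₁ x * P₁ (x + z))) := by
    simp only [hW]
    exact sum_sq_weighted_expand P₀ P₁ w₀ w₁
  -- the pair weights factorise into one-dimensional correlations
  set qcc : ZMod L → ℝ := fun u => ∑ a : ZMod L, pc a * pc (a + u) with hqcc
  set qdd : ZMod L → ℝ := fun u => ∑ a : ZMod L, pd a * pd (a + u) with hqdd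
  set qcd : ZMod L → ℝ := fun u => ∑ a : ZMod L, pc a * pd (a + u) with hqcd
  set qdc : ZMod L → ℝ := fun u => ∑ a : ZMod L, pd a * pc (a + u) with hqdc
  have hΩ₀₀ : ∀ z : ZMod L × ZMod L, ∑ s, w₀ s * w₀ (s + z) = qcc z.1 * qdd z.2 := by
    intro z
    rw [hqcc, hqdd, ← sum_prod_mul_eq (fun a => pc a * pc (a + z.1)) (fun b => pd b * pd (b + z.2))]
    refine Finset.sum_congr rfl fun v _ => ?_
    simp only [hw₀, Prod.fst_add, Prod.snd_add]; ring
  have hΩ₁₁ : ∀ z : ZMod L × ZMod L, ∑ s, w₁ s * w₁ (s + z) = qdd z.1 * qcc z.2 := by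
    intro z
    rw [hqcc, hqdd, ← sum_prod_mul_eq (fun a => pd a * pd (a + z.1)) (fun b => pc b * pc (b + z.2))]
    refine Finset.sum_congr rfl fun v _ => ?_
    simp only [hw₁, Prod.fst_add, Prod.snd_add]; ring
  have hΩ₀₁ : ∀ z : ZMod L × ZMod L, ∑ s, w₀ s * w₁ (s + z) = qcd z.1 * qdc z.2 := by
    intro z
    rw [hqcd, hqdc, ← sum_prod_mul_eq (fun a => pc a * pd (a + z.1)) (fun b => pd b * pc (b + z.2))]
    refine Finset.sum_congr rfl fun v _ => ?_
    simp only [hw₀, hw₁, Prod.fst_add, Prod.snd_add]; ring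
  have hΩ₁₀ : ∀ z : ZMod L × ZMod L, ∑ s, w₁ s * w₀ (s + z) = qdc z.1 * qcd z.2 := by
    intro z
    rw [hqcd, hqdc, ← sum_prod_mul_eq (fun a => pd a * pc (a + z.1)) (fun b => pc b * pd (b + z.2))]
    refine Finset.sum_congr rfl fun v _ => ?_
    simp only [hw₀, hw₁, Prod.fst_add, Prod.snd_add]; ring
  ------------------------------------------------------------------
  -- (d) one-dimensional correlation values and bounds
  ------------------------------------------------------------------
  have h2ℓ : ℓ + ℓ ≤ L := by omega
  have h2ℓ' : ℓ + 1 + (ℓ + 1) ≤ L := by omega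
  have hQ1c' : ∑ i ∈ range ℓ, (if i + 1 < ℓ then c i * c (i + 1) else 0) = Q1c := by
    rw [sum_range_ite_add_lt, hQ1c, show min ℓ (ℓ - 1) = ℓ - 1 by omega]
  have hQ1d' : ∑ i ∈ range (ℓ + 1), (if i + 1 < ℓ + 1 then d i * d (i + 1) else 0) = Q1d := by
    rw [sum_range_ite_add_lt, hQ1d, show min (ℓ + 1) (ℓ + 1 - 1) = ℓ by omega]
  -- values at `0`
  have hqcc0 : qcc 0 = S2c := by
    simp only [hqcc, add_zero]; rw [hpc, sum_per_mul_per_self hℓL le_rfl]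
  have hqdd0 : qdd 0 = S2d := by
    simp only [hqdd, add_zero]; rw [hpd, sum_per_mul_per_self hℓL' le_rfl]
  have hqcd0 : qcd 0 = X := by
    simp only [hqcd, add_zero]; rw [hpc, hpd, sum_per_mul_per_self hℓL (by omega)]
  have hqdc0 : qdc 0 = X := by
    simp only [hqdc, add_zero]
    rw [show (∑ a : ZMod L, pd a * pc a) = ∑ a : ZMod L, pc a * pd a from
      Finset.sum_congr rfl fun a _ => mul_comm _ _]
    rw [hpc, hpd, sum_per_mul_per_self hℓL (by omega)]
  -- values at `+1`
  have hone : ((1 : ℕ) : ZMod L) = 1 := Nat.cast_one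
  have hqcc1 : qcc 1 = Q1c := by
    simp only [hqcc]; rw [← hone, hpc, sum_per_mul_per_add (by omega : 1 + ℓ ≤ L), hQ1c']
  have hqdd1 : qdd 1 = Q1d := by
    simp only [hqdd]; rw [← hone, hpd, sum_per_mul_per_add (by omega : 1 + (ℓ + 1) ≤ L), hQ1d']
  have hqcd1 : qcd 1 = X := by
    simp only [hqcd]
    rw [← hone, hpc, hpd, sum_per_mul_per_add (by omega : 1 + ℓ ≤ L), ← hX1]
    refine Finset.sum_congr rfl fun i hi => ?_
    rw [if_pos (by have := mem_range.1 hi; omega)]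
  -- values at `-1`
  have hqccm1 : qcc (-1) = Q1c := by
    simp only [hqcc]
    have h := sum_mul_sub_eq_sum_mul_add pc pc (1 : ZMod L)
    simp only [sub_eq_add_neg] at h
    rw [h]; exact hqcc1
  have hqddm1 : qdd (-1) = Q1d := by
    simp only [hqdd]
    have h := sum_mul_sub_eq_sum_mul_add pd pd (1 : ZMod L)
    simp only [sub_eq_add_neg] at h
    rw [h]; exact hqdd1
  have hqdcm1 : qdc (-1) = X := by
    simp only [hqdc]
    have h := sum_mul_sub_eq_sum_mul_add pd pc (1 : ZMod L)
    simp only [sub_eq_add_neg] at h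
    rw [h]; exact hqcd1
  -- bounds for all shifts
  have hqcc_le1 : ∀ u : ZMod L, u ≠ 0 → qcc u ≤ Q1c := by
    intro u hu
    simp only [hqcc]; rw [hpc]
    exact sum_per_mul_per_le_of_ne_zero h2ℓ c hQ1c' hcc hu
  have hQ1c_le : Q1c ≤ S2c := by rw [← hQ1c', hS2c]; exact sum_mul_succ_le_sum_mul_self c ℓ
  have hqcc_le0 : ∀ u : ZMod L, qcc u ≤ S2c := by
    intro u
    by_cases hu : u = 0
    · rw [hu, hqcc0]
    · exact (hqcc_le1 u hu).trans hQ1c_le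
  have hqdd_le1 : ∀ u : ZMod L, u ≠ 0 → qdd u ≤ Q1d := by
    intro u hu
    simp only [hqdd]; rw [hpd]
    exact sum_per_mul_per_le_of_ne_zero h2ℓ' d hQ1d' hdd hu
  have hQ1d_le : Q1d ≤ S2d := by rw [← hQ1d', hS2d]; exact sum_mul_succ_le_sum_mul_self d (ℓ + 1)
  have hqdd_le0 : ∀ u : ZMod L, qdd u ≤ S2d := by
    intro u
    by_cases hu : u = 0
    · rw [hu, hqdd0]
    · exact (hqdd_le1 u hu).trans hQ1d_le
  have hqcd_le : ∀ u : ZMod L, qcd u ≤ X := by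
    intro u
    simp only [hqcd]; rw [hpc, hpd]
    exact sum_per_mul_per_le (by omega : ℓ + (ℓ + 1) ≤ L) c d hcd (fun t _ _ => hdc t) u
  have hqdc_le : ∀ u : ZMod L, qdc u ≤ X := by
    intro u
    simp only [hqdc]; rw [hpc, hpd]
    exact sum_per_mul_per_le (by omega : ℓ + 1 + ℓ ≤ L) d c hdc (fun t _ _ => hcd t) u
  -- signs
  have hqcc_nn : ∀ u, 0 ≤ qcc u := fun u => Finset.sum_nonneg fun a _ => mul_nonneg (hpc0 _) (hpc0 _)
  have hqdd_nn : ∀ u, 0 ≤ qdd u := fun u => Finset.sum_nonneg fun a _ => mul_nonneg (hpd0 _) (hpd0 _)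
  have hS2c_nn : 0 ≤ S2c := by rw [← hqcc0]; exact hqcc_nn 0
  have hS2d_nn : 0 ≤ S2d := by rw [← hqdd0]; exact hqdd_nn 0
  ------------------------------------------------------------------
  -- (e) the Knabe-type comparison
  ------------------------------------------------------------------
  have h1ne0 : (1 : ZMod L) ≠ 0 := by
    have h := natCast_ne_natCast_zmod (N := L) (a := 1) (b := 0) (by omega) (by omega) (by omega)
    simpa using h
  have hm1ne0 : (-1 : ZMod L) ≠ 0 := fun h => h1ne0 (neg_eq_zero.1 h)
  have hcomp := sq_comparison_squareLattice hL3 P₀ P₁ hh₀ hi₀ hh₁ hi₁ hc00 hc11 hc01 hc10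
    (fun z => ∑ s, w₀ s * w₀ (s + z)) (fun z => ∑ s, w₀ s * w₁ (s + z))
    (fun z => ∑ s, w₁ s * w₀ (s + z)) (fun z => ∑ s, w₁ s * w₁ (s + z)) K₀ K₁ K₃ hK13
    (by rw [hΩ₀₀, Prod.fst_zero, Prod.snd_zero, hqcc0, hqdd0, hK₀])
    (by rw [hΩ₀₀, hqcc1, hqdd0, hK₁])
    (by rw [hΩ₀₀, hqccm1, hqdd0, hK₁])
    (by
      intro z hz0 hzp hzm
      rw [hΩ₀₀]
      by_cases h2 : z.2 = 0
      · -- then `z.1 ∉ {0, 1, -1}`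
        have h1 : z.1 ≠ 0 := fun h => hz0 (Prod.ext h h2)
        have h1p : z.1 ≠ 1 := fun h => hzp (Prod.ext h h2)
        have h1m : z.1 ≠ -1 := fun h => hzm (Prod.ext h h2)
        rw [h2, hqdd0]
        calc qcc z.1 * S2d ≤ Q1c * S2d := mul_le_mul_of_nonneg_right (hqcc_le1 _ h1) hS2d_nn
          _ = K₁ := hK₁.symm
          _ ≤ K₃ := hK13
      · calc qcc z.1 * qdd z.2 ≤ S2c * Q1d :=
            mul_le_mul (hqcc_le0 _) (hqdd_le1 _ h2) (hqdd_nn _) hS2c_nn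
          _ = K₂ := hK₂.symm
          _ ≤ K₃ := hK23)
    (by rw [hΩ₁₁, Prod.fst_zero, Prod.snd_zero, hqcc0, hqdd0, hK₀, mul_comm])
    (by rw [hΩ₁₁, hqdd0, hqcc1, hK₁, mul_comm])
    (by rw [hΩ₁₁, hqdd0, hqccm1, hK₁, mul_comm])
    (by
      intro z hz0 hzp hzm
      rw [hΩ₁₁]
      by_cases h1 : z.1 = 0
      · have h2 : z.2 ≠ 0 := fun h => hz0 (Prod.ext h1 h)
        have h2p : z.2 ≠ 1 := fun h => hzp (Prod.ext h1 h)
        have h2m : z.2 ≠ -1 := fun h => hzm (Prod.ext h1 h)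
        rw [h1, hqdd0]
        calc S2d * qcc z.2 ≤ S2d * Q1c := mul_le_mul_of_nonneg_left (hqcc_le1 _ h2) hS2d_nn
          _ = K₁ := by rw [hK₁, mul_comm]
          _ ≤ K₃ := hK13
      · calc qdd z.1 * qcc z.2 ≤ Q1d * S2c :=
            mul_le_mul (hqdd_le1 _ h1) (hqcc_le0 _) (hqcc_nn _) ((hqdd_nn _).trans (hqdd_le1 _ h1))
          _ = K₂ := by rw [hK₂, mul_comm]
          _ ≤ K₃ := hK23)
    (by rw [hΩ₀₁, Prod.fst_zero, Prod.snd_zero, hqcd0, hqdc0, hK₃, sq])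
    (by rw [hΩ₀₁, hqcd1, hqdc0, hK₃, sq])
    (by rw [hΩ₀₁, hqcd0, hqdcm1, hK₃, sq])
    (by rw [hΩ₀₁, hqcd1, hqdcm1, hK₃, sq])
    (by
      intro z
      rw [hΩ₀₁, hK₃, sq]
      exact mul_le_mul (hqcd_le _) (hqdc_le _)
        (Finset.sum_nonneg fun a _ => mul_nonneg (hpd0 _) (hpc0 _)) (hX.symm ▸ le_trans
          (Finset.sum_nonneg fun a _ => mul_nonneg (hpc0 _) (hpd0 _)) (hqcd_le 0)))
    (by rw [hΩ₁₀, Prod.fst_zero, Prod.snd_zero, hqcd0, hqdc0, hK₃, sq])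
    (by rw [hΩ₁₀, hqdcm1, hqcd0, hK₃, sq])
    (by rw [hΩ₁₀, hqdc0, hqcd1, hK₃, sq])
    (by rw [hΩ₁₀, hqdcm1, hqcd1, hK₃, sq])
    (by
      intro z
      rw [hΩ₁₀, hK₃, sq]
      exact mul_le_mul (hqdc_le _) (hqcd_le _)
        (Finset.sum_nonneg fun a _ => mul_nonneg (hpc0 _) (hpd0 _)) (hX.symm ▸ le_trans
          (Finset.sum_nonneg fun a _ => mul_nonneg (hpc0 _) (hpd0 _)) (hqcd_le 0)))
    (by rw [← hexpW]; exact (posSemidef_sum _ fun t _ => by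
      have h := posSemidef_conjTranspose_mul_self (W t); rwa [(hBherm t).eq] at h).1)
  ------------------------------------------------------------------
  -- (f) assembly
  ------------------------------------------------------------------
  rw [← hexpW] at hcomp
  -- `hfam : Σ W² - (ε K₄) H ≥ 0`, `hcomp : K₃ H² + κ H - Σ W² ≥ 0`
  have hK4' : ε * (S1c * S1d) ^ 2 / ((ℓ : ℝ) * (ℓ + 1)) = ε * K₄ := by
    rw [hK₄]; ring
  rw [hK4'] at hfam
  have hsum := hcomp.add hfam
  set κ : ℝ := K₀ + K₃ - 2 * K₁ with hκ
  clear_value κ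
  have hcoef : K₃ * (K₄ / K₃ * (ε - κ / K₄)) = ε * K₄ - κ := by
    have hK3ne : K₃ ≠ 0 := hK3.ne'
    have hK4ne : K₄ ≠ 0 := hK4.ne'
    rw [← mul_assoc, mul_div_cancel₀ _ hK3ne, mul_sub, mul_div_cancel₀ _ hK4ne, mul_comm]
  have hid : (K₃ : ℂ) • (H * H) + (κ : ℂ) • H - ∑ t, W t * W t +
      (∑ t, W t * W t - ((ε * K₄ : ℝ) : ℂ) • H) =
      (K₃ : ℂ) • (H * H - ((K₄ / K₃ * (ε - κ / K₄) : ℝ) : ℂ) • H) := by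
    rw [smul_sub, smul_smul, ← Complex.ofReal_mul, hcoef, Complex.ofReal_sub, sub_smul]
    abel
  rw [hid] at hsum
  have hscale := hsum.smul (Complex.zero_le_real.2 (inv_nonneg.2 hK3.le))
  rwa [smul_smul, ← Complex.ofReal_mul, inv_mul_cancel₀ hK3.ne', Complex.ofReal_one, one_smul] at hscale

/-! ### §8 Corollary: unit weights — a Knabe-type criterion on the square lattice (threshold `(ℓ+2)/(ℓ(ℓ+1))`) -/

/-- **Knabe-type finite-size criterion on the periodic square lattice (unit weights).**  In the setting of
`squareLattice_sq_sub_smul_posSemidef` (torus `(ℤ/L)²`, `L ≥ 2ℓ + 2`, nearest-neighbour orthogonal projections,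
every open `ℓ × ℓ` box — `(ℓ+1)²` sites — with local gap `ε`): `H² - ((ℓ+1)/ℓ) (ε - (ℓ+2)/(ℓ(ℓ+1))) H ≥ 0`, i.e.
"`γ_L^per ≥ ((ℓ+1)/ℓ)(γ_ℓ - (ℓ+2)/(ℓ(ℓ+1)))`" — the case `c ≡ d ≡ 1` of the general bound (`K₀ = ℓ(ℓ+1)`,
`K₁ = (ℓ-1)(ℓ+1)`, `K₂ = K₃ = ℓ²`, `K₄ = ℓ(ℓ+1)`), a local gap threshold `Θ(ℓ⁻¹)` as in Knabe's original bound and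
in Lemm's `D`-dimensional criterion. [cite: LemmXiang2022, §3.1 Prop. 3.1 with constant weights; §2.1 (Knabe's
threshold `1/ℓ`)] [cite: Knabe1988, §2] -/
theorem squareLattice_sq_sub_smul_posSemidef_unitWeights {L : ℕ} [NeZero L] {ℓ : ℕ} (hℓ : 1 ≤ ℓ)
    (hL : 2 * ℓ + 2 ≤ L) (P₀ P₁ : ZMod L × ZMod L → Matrix n n ℂ) (hh₀ : ∀ x, (P₀ x).IsHermitian)
    (hi₀ : ∀ x, P₀ x * P₀ x = P₀ x) (hh₁ : ∀ x, (P₁ x).IsHermitian) (hi₁ : ∀ x, P₁ x * P₁ x = P₁ x)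
    (hc00 : ∀ x z : ZMod L × ZMod L, z ≠ 0 → z ≠ (1, 0) → z ≠ (-1, 0) →
      P₀ x * P₀ (x + z) = P₀ (x + z) * P₀ x)
    (hc11 : ∀ x z : ZMod L × ZMod L, z ≠ 0 → z ≠ (0, 1) → z ≠ (0, -1) →
      P₁ x * P₁ (x + z) = P₁ (x + z) * P₁ x)
    (hc01 : ∀ x z : ZMod L × ZMod L, z ≠ 0 → z ≠ (1, 0) → z ≠ (0, -1) → z ≠ (1, -1) →
      P₀ x * P₁ (x + z) = P₁ (x + z) * P₀ x)
    (hc10 : ∀ x z : ZMod L × ZMod L, z ≠ 0 → z ≠ (-1, 0) → z ≠ (0, 1) → z ≠ (-1, 1) →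
      P₁ x * P₀ (x + z) = P₀ (x + z) * P₁ x)
    {ε : ℝ} (hε : 0 < ε)
    (hloc : ∀ t : ZMod L × ZMod L,
      (((∑ a ∈ range ℓ, ∑ b ∈ range (ℓ + 1), P₀ (t + ((a : ZMod L), (b : ZMod L)))) +
          ∑ a ∈ range (ℓ + 1), ∑ b ∈ range ℓ, P₁ (t + ((a : ZMod L), (b : ZMod L)))) *
        ((∑ a ∈ range ℓ, ∑ b ∈ range (ℓ + 1), P₀ (t + ((a : ZMod L), (b : ZMod L)))) +
          ∑ a ∈ range (ℓ + 1), ∑ b ∈ range ℓ, P₁ (t + ((a : ZMod L), (b : ZMod L)))) -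
        (ε : ℂ) • ((∑ a ∈ range ℓ, ∑ b ∈ range (ℓ + 1), P₀ (t + ((a : ZMod L), (b : ZMod L)))) +
          ∑ a ∈ range (ℓ + 1), ∑ b ∈ range ℓ, P₁ (t + ((a : ZMod L), (b : ZMod L))))).PosSemidef) :
    ((∑ x, (P₀ x + P₁ x)) * (∑ x, (P₀ x + P₁ x)) -
      ((((ℓ : ℝ) + 1) / ℓ * (ε - ((ℓ : ℝ) + 2) / ((ℓ : ℝ) * (ℓ + 1))) : ℝ) : ℂ) •
        ∑ x, (P₀ x + P₁ x)).PosSemidef := by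
  have hℓ0 : (0 : ℝ) < ℓ := by exact_mod_cast hℓ
  -- the indicator sums
  have hone' : ∀ m : ℕ, ∑ _i ∈ range m, (1 : ℝ) = m := by
    intro m; rw [sum_const, card_range, nsmul_eq_mul, mul_one]
  have hone : ∀ m : ℕ, ∑ i ∈ range m, (1 : ℝ) * 1 = m := by
    intro m; rw [mul_one, hone']
  have hite : ∀ m m' t : ℕ, ∑ i ∈ range m, (if i + t < m' then (1 : ℝ) * 1 else 0) = ((min m (m' - t) : ℕ) : ℝ) := by
    intro m m' t; rw [sum_range_ite_add_lt, hone]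
  have hℓ1 : ((ℓ - 1 : ℕ) : ℝ) = (ℓ : ℝ) - 1 := by rw [Nat.cast_sub hℓ, Nat.cast_one]
  have h := squareLattice_sq_sub_smul_posSemidef hℓ hL P₀ P₁ hh₀ hi₀ hh₁ hi₁ hc00 hc11 hc01 hc10 hε hloc
    (fun _ => 1) (fun _ => 1) (fun _ _ => zero_le_one) (fun _ _ => zero_le_one)
    (by
      intro t ht
      rw [hite, hone]
      exact_mod_cast (by omega : min ℓ (ℓ - t) ≤ ℓ - 1))
    (by
      intro t ht
      rw [hite, hone]
      exact_mod_cast (by omega : min (ℓ + 1) (ℓ + 1 - t) ≤ ℓ))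
    (by
      intro t
      rw [hite, hone]
      exact_mod_cast (by omega : min ℓ (ℓ + 1 - t) ≤ ℓ))
    (by
      intro t
      rw [hite, hone]
      exact_mod_cast (by omega : min (ℓ + 1) (ℓ - t) ≤ ℓ))
    rfl (((ℓ : ℝ)) * (ℓ + 1)) (((ℓ : ℝ) - 1) * (ℓ + 1)) ((ℓ : ℝ) * ℓ) ((ℓ : ℝ) ^ 2)
    ((ℓ : ℝ) * (ℓ + 1))
    (by rw [hone, hone]; push_cast; ring)
    (by rw [hone, hone, hℓ1]; push_cast; ring)
    (by simp only [hone])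
    (by rw [hone, sq])
    (by rw [hone', hone']; push_cast; field_simp)
    (by nlinarith) (by nlinarith) (by positivity) (by positivity)
  have hcoef : (ℓ : ℝ) * (ℓ + 1) / (ℓ : ℝ) ^ 2 *
      (ε - ((ℓ : ℝ) * (ℓ + 1) + (ℓ : ℝ) ^ 2 - 2 * (((ℓ : ℝ) - 1) * (ℓ + 1))) / ((ℓ : ℝ) * (ℓ + 1))) =
      ((ℓ : ℝ) + 1) / ℓ * (ε - ((ℓ : ℝ) + 2) / ((ℓ : ℝ) * (ℓ + 1))) := by
    have hℓne : (ℓ : ℝ) ≠ 0 := hℓ0.ne'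
    have hℓ1ne : (ℓ : ℝ) + 1 ≠ 0 := by positivity
    field_simp
    ring
  rw [hcoef] at h
  exact h

/-- The printed (eigenvalue) form of `squareLattice_sq_sub_smul_posSemidef_unitWeights`: every eigenvalue of the
torus Hamiltonian `H = Σ_x (P₀ x + P₁ x)` is `0` or at least `((ℓ+1)/ℓ)(ε - (ℓ+2)/(ℓ(ℓ+1)))`; in particular (`H`
frustration-free) `γ_L^per ≥ ((ℓ+1)/ℓ)(γ_ℓ - (ℓ+2)/(ℓ(ℓ+1)))`. [cite: LemmXiang2022, §2.1 eq. (generic), §3.1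
Prop. 3.1 with constant weights] -/
theorem squareLattice_sq_sub_smul_posSemidef_unitWeights_eigenvalue_eq_zero_or_le {L : ℕ} [NeZero L] {ℓ : ℕ}
    (hℓ : 1 ≤ ℓ) (hL : 2 * ℓ + 2 ≤ L) (P₀ P₁ : ZMod L × ZMod L → Matrix n n ℂ) (hh₀ : ∀ x, (P₀ x).IsHermitian)
    (hi₀ : ∀ x, P₀ x * P₀ x = P₀ x) (hh₁ : ∀ x, (P₁ x).IsHermitian) (hi₁ : ∀ x, P₁ x * P₁ x = P₁ x)
    (hc00 : ∀ x z : ZMod L × ZMod L, z ≠ 0 → z ≠ (1, 0) → z ≠ (-1, 0) →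
      P₀ x * P₀ (x + z) = P₀ (x + z) * P₀ x)
    (hc11 : ∀ x z : ZMod L × ZMod L, z ≠ 0 → z ≠ (0, 1) → z ≠ (0, -1) →
      P₁ x * P₁ (x + z) = P₁ (x + z) * P₁ x)
    (hc01 : ∀ x z : ZMod L × ZMod L, z ≠ 0 → z ≠ (1, 0) → z ≠ (0, -1) → z ≠ (1, -1) →
      P₀ x * P₁ (x + z) = P₁ (x + z) * P₀ x)
    (hc10 : ∀ x z : ZMod L × ZMod L, z ≠ 0 → z ≠ (-1, 0) → z ≠ (0, 1) → z ≠ (-1, 1) →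
      P₁ x * P₀ (x + z) = P₀ (x + z) * P₁ x)
    {ε : ℝ} (hε : 0 < ε)
    (hloc : ∀ t : ZMod L × ZMod L,
      (((∑ a ∈ range ℓ, ∑ b ∈ range (ℓ + 1), P₀ (t + ((a : ZMod L), (b : ZMod L)))) +
          ∑ a ∈ range (ℓ + 1), ∑ b ∈ range ℓ, P₁ (t + ((a : ZMod L), (b : ZMod L)))) *
        ((∑ a ∈ range ℓ, ∑ b ∈ range (ℓ + 1), P₀ (t + ((a : ZMod L), (b : ZMod L)))) +
          ∑ a ∈ range (ℓ + 1), ∑ b ∈ range ℓ, P₁ (t + ((a : ZMod L), (b : ZMod L)))) -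
        (ε : ℂ) • ((∑ a ∈ range ℓ, ∑ b ∈ range (ℓ + 1), P₀ (t + ((a : ZMod L), (b : ZMod L)))) +
          ∑ a ∈ range (ℓ + 1), ∑ b ∈ range ℓ, P₁ (t + ((a : ZMod L), (b : ZMod L))))).PosSemidef)
    {μ : ℝ} {v : n → ℂ} (hv : (∑ x, (P₀ x + P₁ x)) *ᵥ v = (μ : ℂ) • v) (hv0 : v ≠ 0) :
    μ = 0 ∨ ((ℓ : ℝ) + 1) / ℓ * (ε - ((ℓ : ℝ) + 2) / ((ℓ : ℝ) * (ℓ + 1))) ≤ μ := by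
  have hH : (∑ x, (P₀ x + P₁ x)).PosSemidef :=
    posSemidef_sum _ fun x _ => (posSemidef_of_isHermitian_of_mul_self (hh₀ x) (hi₀ x)).add
      (posSemidef_of_isHermitian_of_mul_self (hh₁ x) (hi₁ x))
  exact eigenvalue_eq_zero_or_le_of_sq_sub_smul_posSemidef hH
    (squareLattice_sq_sub_smul_posSemidef_unitWeights hℓ hL P₀ P₁ hh₀ hi₀ hh₁ hi₁ hc00 hc11 hc01 hc10 hε hloc)
    hv hv0

/-! ### §9 The product weights of Gosset–Mozgunov / Lemm–Xiang (`c_i = (i+1)(ℓ-i)`, `d_i = (i+1)(ℓ+1-i)`):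
closed forms, autocorrelation monotonicity, and the `ℓ⁻²` criterion -/

/-- `6 Σ_{i<M} (i+1)(a-i) = 2M + 3Ma + 3M²a - 2M³`. [folklore] -/
private theorem gm_sum_lin (M : ℕ) (a : ℝ) :
    6 * ∑ i ∈ range M, ((i : ℝ) + 1) * (a - i) =
      2 * M + 3 * M * a + 3 * (M : ℝ) ^ 2 * a - 2 * (M : ℝ) ^ 3 := by
  induction M with
  | zero => simp
  | succ M ih =>
    rw [sum_range_succ, mul_add, ih]
    push_cast
    ring

/-- Master autocorrelation sum of the quadratic weights, `60 Σ_{i<M} (i+1)(a-i)(i+t+1)(b-i-t)`, in closed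
form (Faulhaber). [folklore] -/
private theorem gm_sum_master (M t : ℕ) (a b : ℝ) :
    60 * ∑ i ∈ range M, ((i : ℝ) + 1) * (a - i) * ((((i + t : ℕ) : ℝ) + 1) * (b - ((i + t : ℕ) : ℝ))) =
      8 * M + 10 * M * b + 10 * M * a + 10 * M * a * b + 20 * M * t * b + 10 * M * t * a
        + 30 * M * t * a * b - 20 * M * (t : ℝ) ^ 2 - 30 * M * (t : ℝ) ^ 2 * a + 15 * (M : ℝ) ^ 2 * b
        + 15 * (M : ℝ) ^ 2 * a + 30 * (M : ℝ) ^ 2 * a * b - 30 * (M : ℝ) ^ 2 * t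
        - 30 * (M : ℝ) ^ 2 * t * a + 30 * (M : ℝ) ^ 2 * t * a * b - 30 * (M : ℝ) ^ 2 * (t : ℝ) ^ 2 * a
        - 20 * (M : ℝ) ^ 3 - 10 * (M : ℝ) ^ 3 * b - 10 * (M : ℝ) ^ 3 * a + 20 * (M : ℝ) ^ 3 * a * b
        - 20 * (M : ℝ) ^ 3 * t * b - 40 * (M : ℝ) ^ 3 * t * a + 20 * (M : ℝ) ^ 3 * (t : ℝ) ^ 2
        - 15 * (M : ℝ) ^ 4 * b - 15 * (M : ℝ) ^ 4 * a + 30 * (M : ℝ) ^ 4 * t + 12 * (M : ℝ) ^ 5 := by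
  induction M with
  | zero => simp
  | succ M ih =>
    rw [sum_range_succ, mul_add, ih]
    push_cast
    ring

/-- The weights `(i+1)(μ-i)` are nonnegative on their support `i < m = μ`. [folklore] -/
private theorem gm_w_nonneg {m i : ℕ} {μ : ℝ} (hμ : μ = m) (hi : i < m) : 0 ≤ ((i : ℝ) + 1) * (μ - i) := by
  subst hμ
  have : (i : ℝ) < m := by exact_mod_cast hi
  exact mul_nonneg (by positivity) (by linarith)

/-- `Σ_{i<m} (i+1)(m-i) = m(m+1)(m+2)/6`. [folklore] -/
private theorem gm_S1 (m : ℕ) {μ : ℝ} (hμ : μ = m) :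
    ∑ i ∈ range m, ((i : ℝ) + 1) * (μ - i) = μ * (μ + 1) * (μ + 2) / 6 := by
  subst hμ
  linear_combination (gm_sum_lin m (m : ℝ)) / 6

/-- `Σ_{i<m} ((i+1)(m-i))² = m(m+1)(m+2)(m²+2m+2)/30`. [folklore] -/
private theorem gm_S2 (m : ℕ) {μ : ℝ} (hμ : μ = m) :
    ∑ i ∈ range m, ((i : ℝ) + 1) * (μ - i) * (((i : ℝ) + 1) * (μ - i)) =
      μ * (μ + 1) * (μ + 2) * (μ ^ 2 + 2 * μ + 2) / 30 := by
  subst hμ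
  have h := gm_sum_master m 0 (m : ℝ) (m : ℝ)
  simp only [Nat.add_zero, Nat.cast_zero] at h
  linear_combination h / 60

/-- `Σ_{i<m-1} (i+1)(m-i)(i+2)(m-i-1) = m(m-1)(m+1)(m+2)(m+3)/30`. [folklore] -/
private theorem gm_Q1 (m : ℕ) {μ : ℝ} (hμ : μ = m) (hm : 1 ≤ m) :
    ∑ i ∈ range (m - 1), ((i : ℝ) + 1) * (μ - i) * ((((i + 1 : ℕ) : ℝ) + 1) * (μ - ((i + 1 : ℕ) : ℝ))) =
      μ * (μ - 1) * (μ + 1) * (μ + 2) * (μ + 3) / 30 := by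
  subst hμ
  have h := gm_sum_master (m - 1) 1 (m : ℝ) (m : ℝ)
  rw [Nat.cast_sub hm, Nat.cast_one] at h
  linear_combination h / 60

/-- `Σ_{i<ℓ} (i+1)(ℓ-i)(i+1)(ℓ+1-i) = ℓ(ℓ+1)(ℓ+2)(ℓ+3)(2ℓ+3)/60`. [folklore] -/
private theorem gm_X (ℓ : ℕ) :
    ∑ i ∈ range ℓ, ((i : ℝ) + 1) * ((ℓ : ℝ) - i) * (((i : ℝ) + 1) * ((ℓ : ℝ) + 1 - i)) =
      (ℓ : ℝ) * (ℓ + 1) * (ℓ + 2) * (ℓ + 3) * (2 * ℓ + 3) / 60 := by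
  have h := gm_sum_master ℓ 0 (ℓ : ℝ) ((ℓ : ℝ) + 1)
  simp only [Nat.add_zero, Nat.cast_zero] at h
  linear_combination h / 60

/-- Corner symmetry `Σ_{i<ℓ} c_i d_{i+1} = Σ_{i<ℓ} c_i d_i` ("relabelling the summation indices").
[cite: LemmXiang2022, §3.2] -/
private theorem gm_cross_succ (ℓ : ℕ) :
    ∑ i ∈ range ℓ, ((i : ℝ) + 1) * ((ℓ : ℝ) - i) * ((((i + 1 : ℕ) : ℝ) + 1) * ((ℓ : ℝ) + 1 - ((i + 1 : ℕ) : ℝ))) =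
      ∑ i ∈ range ℓ, ((i : ℝ) + 1) * ((ℓ : ℝ) - i) * (((i : ℝ) + 1) * ((ℓ : ℝ) + 1 - i)) := by
  have h1 := gm_sum_master ℓ 1 (ℓ : ℝ) ((ℓ : ℝ) + 1)
  have h2 := gm_X ℓ
  push_cast at h1 ⊢
  linarith

/-- Collinear autocorrelation monotonicity for `w_i = (i+1)(m-i)`: `Σ_i w_i w_{i+t} ≤ Σ_i w_i w_{i+1}` for `t ≥ 2`
("monotonically decreasing in the distances"). [cite: LemmXiang2022, §3.2] -/
private theorem gm_shift_le (m : ℕ) {μ : ℝ} (hμ : μ = m) (t : ℕ) (ht : 2 ≤ t) :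
    ∑ i ∈ range m, (if i + t < m then
        ((i : ℝ) + 1) * (μ - i) * ((((i + t : ℕ) : ℝ) + 1) * (μ - ((i + t : ℕ) : ℝ))) else 0) ≤
      ∑ i ∈ range (m - 1), ((i : ℝ) + 1) * (μ - i) * ((((i + 1 : ℕ) : ℝ) + 1) * (μ - ((i + 1 : ℕ) : ℝ))) := by
  subst hμ
  rw [sum_range_ite_add_lt, min_eq_right (Nat.sub_le m t)]
  rcases Nat.lt_or_ge t m with htm | htm
  · obtain ⟨s, rfl⟩ : ∃ s, t = s + 2 := ⟨t - 2, by omega⟩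
    obtain ⟨k, rfl⟩ : ∃ k, m = s + 3 + k := ⟨m - (s + 3), by omega⟩
    rw [show s + 3 + k - (s + 2) = k + 1 by omega, show s + 3 + k - 1 = s + 2 + k by omega]
    have h1 := gm_sum_master (k + 1) (s + 2) ((s + 3 + k : ℕ) : ℝ) ((s + 3 + k : ℕ) : ℝ)
    have h2 := gm_sum_master (s + 2 + k) 1 ((s + 3 + k : ℕ) : ℝ) ((s + 3 + k : ℕ) : ℝ)
    have hD : (0 : ℝ) ≤ 5 * (k : ℝ) ^ 3 * (s : ℝ) ^ 2 + 20 * (k : ℝ) ^ 3 * s + 15 * (k : ℝ) ^ 3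
        + 10 * (k : ℝ) ^ 2 * (s : ℝ) ^ 3 + 90 * (k : ℝ) ^ 2 * (s : ℝ) ^ 2 + 230 * (k : ℝ) ^ 2 * s
        + 150 * (k : ℝ) ^ 2 + 5 * k * (s : ℝ) ^ 4 + 80 * k * (s : ℝ) ^ 3 + 410 * k * (s : ℝ) ^ 2
        + 800 * k * s + 465 * k + (s : ℝ) ^ 5 + 20 * (s : ℝ) ^ 4 + 155 * (s : ℝ) ^ 3
        + 550 * (s : ℝ) ^ 2 + 864 * s + 450 := by positivity
    push_cast at h1 h2 ⊢
    linarith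
  · rw [Nat.sub_eq_zero_of_le htm, sum_range_zero]
    exact sum_nonneg fun i hi => mul_nonneg (gm_w_nonneg rfl (by have := mem_range.1 hi; omega))
      (gm_w_nonneg rfl (by have := mem_range.1 hi; omega))

/-- Perpendicular autocorrelation bound `Σ_i c_i d_{i+t} ≤ Σ_i c_i d_i` (all `t`). [cite: LemmXiang2022, §3.2] -/
private theorem gm_cross_le (ℓ t : ℕ) :
    ∑ i ∈ range ℓ, (if i + t < ℓ + 1 then
        ((i : ℝ) + 1) * ((ℓ : ℝ) - i) * ((((i + t : ℕ) : ℝ) + 1) * ((ℓ : ℝ) + 1 - ((i + t : ℕ) : ℝ))) else 0) ≤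
      ∑ i ∈ range ℓ, ((i : ℝ) + 1) * ((ℓ : ℝ) - i) * (((i : ℝ) + 1) * ((ℓ : ℝ) + 1 - i)) := by
  rw [sum_range_ite_add_lt]
  rcases Nat.lt_or_ge t 2 with ht | ht
  · interval_cases t
    · rw [show min ℓ (ℓ + 1 - 0) = ℓ by omega]
      simp only [Nat.add_zero, le_refl]
    · rw [show min ℓ (ℓ + 1 - 1) = ℓ by omega, gm_cross_succ]
  rcases Nat.lt_or_ge ℓ t with htl | htl
  · rw [show min ℓ (ℓ + 1 - t) = 0 by omega, sum_range_zero]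
    exact sum_nonneg fun i hi => mul_nonneg (gm_w_nonneg rfl (mem_range.1 hi))
      (gm_w_nonneg (m := ℓ + 1) (by norm_cast) (by have := mem_range.1 hi; omega))
  · obtain ⟨s, rfl⟩ : ∃ s, t = s + 2 := ⟨t - 2, by omega⟩
    obtain ⟨k, rfl⟩ : ∃ k, ℓ = s + 2 + k := ⟨ℓ - (s + 2), by omega⟩
    rw [show min (s + 2 + k) (s + 2 + k + 1 - (s + 2)) = k + 1 by omega]
    have h1 := gm_sum_master (k + 1) (s + 2) ((s + 2 + k : ℕ) : ℝ) (((s + 2 + k : ℕ) : ℝ) + 1)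
    have h2 := gm_X (s + 2 + k)
    have hD : (0 : ℝ) ≤ 10 * (k : ℝ) ^ 3 * (s : ℝ) ^ 2 + 30 * (k : ℝ) ^ 3 * s + 20 * (k : ℝ) ^ 3
        + 20 * (k : ℝ) ^ 2 * (s : ℝ) ^ 3 + 150 * (k : ℝ) ^ 2 * (s : ℝ) ^ 2 + 310 * (k : ℝ) ^ 2 * s
        + 180 * (k : ℝ) ^ 2 + 10 * k * (s : ℝ) ^ 4 + 140 * k * (s : ℝ) ^ 3 + 610 * k * (s : ℝ) ^ 2
        + 1000 * k * s + 520 * k + 2 * (s : ℝ) ^ 5 + 35 * (s : ℝ) ^ 4 + 240 * (s : ℝ) ^ 3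
        + 745 * (s : ℝ) ^ 2 + 1018 * s + 480 := by positivity
    push_cast at h1 h2 ⊢
    linarith

/-- The mirror perpendicular bound `Σ_i d_i c_{i+t} ≤ Σ_i c_i d_i` (all `t`). [cite: LemmXiang2022, §3.2] -/
private theorem gm_cross_le' (ℓ t : ℕ) :
    ∑ i ∈ range (ℓ + 1), (if i + t < ℓ then
        ((i : ℝ) + 1) * ((ℓ : ℝ) + 1 - i) * ((((i + t : ℕ) : ℝ) + 1) * ((ℓ : ℝ) - ((i + t : ℕ) : ℝ))) else 0) ≤
      ∑ i ∈ range ℓ, ((i : ℝ) + 1) * ((ℓ : ℝ) - i) * (((i : ℝ) + 1) * ((ℓ : ℝ) + 1 - i)) := by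
  rw [sum_range_ite_add_lt, min_eq_right (by omega : ℓ - t ≤ ℓ + 1)]
  rcases Nat.eq_zero_or_pos t with rfl | ht
  · rw [Nat.sub_zero]
    refine le_of_eq (sum_congr rfl fun i _ => ?_)
    rw [Nat.add_zero]
    ring
  rcases Nat.lt_or_ge t ℓ with htl | htl
  · obtain ⟨s, rfl⟩ : ∃ s, t = s + 1 := ⟨t - 1, by omega⟩
    obtain ⟨k, rfl⟩ : ∃ k, ℓ = s + 2 + k := ⟨ℓ - (s + 2), by omega⟩
    rw [show s + 2 + k - (s + 1) = k + 1 by omega]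
    have h1 := gm_sum_master (k + 1) (s + 1) (((s + 2 + k : ℕ) : ℝ) + 1) ((s + 2 + k : ℕ) : ℝ)
    have h2 := gm_X (s + 2 + k)
    have hD : (0 : ℝ) ≤ 10 * (k : ℝ) ^ 3 * (s : ℝ) ^ 2 + 30 * (k : ℝ) ^ 3 * s + 20 * (k : ℝ) ^ 3
        + 20 * (k : ℝ) ^ 2 * (s : ℝ) ^ 3 + 150 * (k : ℝ) ^ 2 * (s : ℝ) ^ 2 + 310 * (k : ℝ) ^ 2 * s
        + 180 * (k : ℝ) ^ 2 + 10 * k * (s : ℝ) ^ 4 + 140 * k * (s : ℝ) ^ 3 + 610 * k * (s : ℝ) ^ 2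
        + 1000 * k * s + 520 * k + 2 * (s : ℝ) ^ 5 + 35 * (s : ℝ) ^ 4 + 240 * (s : ℝ) ^ 3
        + 745 * (s : ℝ) ^ 2 + 1018 * s + 480 := by positivity
    push_cast at h1 h2 ⊢
    linarith
  · rw [Nat.sub_eq_zero_of_le htl, sum_range_zero]
    exact sum_nonneg fun i hi => mul_nonneg (gm_w_nonneg rfl (mem_range.1 hi))
      (gm_w_nonneg (m := ℓ + 1) (by norm_cast) (by have := mem_range.1 hi; omega))

/-- **Lemm–Xiang's Prop. 3.1 (`D = 2`) with the product weights `c_i = (i+1)(ℓ-i)`, `d_i = (i+1)(ℓ+1-i)`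
(their eq. (cjchoice) with `λ = 0`, the Gosset–Mozgunov-type choice), constants evaluated in closed form:**
`K₀ = S₂(ℓ)S₂'(ℓ)`, `K₁ = Q₁(ℓ)S₂'(ℓ)`, `K₃ = X(ℓ)²`, `K₄ = S₁(ℓ)²S₁'(ℓ)²/(ℓ(ℓ+1))` with
`S₁ = ℓ(ℓ+1)(ℓ+2)/6`, `S₁' = (ℓ+1)(ℓ+2)(ℓ+3)/6`, `S₂ = ℓ(ℓ+1)(ℓ+2)(ℓ²+2ℓ+2)/30`,
`S₂' = (ℓ+1)(ℓ+2)(ℓ+3)(ℓ²+4ℓ+5)/30`, `Q₁ = (ℓ-1)ℓ(ℓ+1)(ℓ+2)(ℓ+3)/30`, `X = ℓ(ℓ+1)(ℓ+2)(ℓ+3)(2ℓ+3)/60`, whence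
`K₄/K₃ = 25(ℓ+1)(ℓ+2)²/(9ℓ(2ℓ+3)²)` and local gap threshold
`(K₀+K₃-2K₁)/K₄ = 9(5ℓ²+23ℓ+32)/(5(ℓ+1)(ℓ+2)²(ℓ+3)) ≤ 9/ℓ²`:
`H² - (25(ℓ+1)(ℓ+2)²/(9ℓ(2ℓ+3)²)) (ε - 9(5ℓ²+23ℓ+32)/(5(ℓ+1)(ℓ+2)²(ℓ+3))) H ≥ 0` on the torus `(ℤ/L)²`,
`L ≥ 2ℓ + 2`, `ℓ ≥ 1`.  (The printed optimum, `λ = 2(√2-1)/ℓ`, gives `(25/36)(γ_ℓ - 7.2/ℓ² - O(ℓ⁻³))`;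
Gosset–Mozgunov's patches give `(3/4)(ε - 8/n²)`.) [cite: LemmXiang2022, §3.1 Prop. 3.1, §3.6 eq. (cjchoice)]
[cite: GossetMozgunov2016, §3 Thm. 5] -/
theorem squareLattice_sq_sub_smul_posSemidef_gmWeights_exact {L : ℕ} [NeZero L] {ℓ : ℕ}
    (hℓ : 1 ≤ ℓ) (hL : 2 * ℓ + 2 ≤ L) (P₀ P₁ : ZMod L × ZMod L → Matrix n n ℂ) (hh₀ : ∀ x, (P₀ x).IsHermitian)
    (hi₀ : ∀ x, P₀ x * P₀ x = P₀ x) (hh₁ : ∀ x, (P₁ x).IsHermitian) (hi₁ : ∀ x, P₁ x * P₁ x = P₁ x)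
    (hc00 : ∀ x z : ZMod L × ZMod L, z ≠ 0 → z ≠ (1, 0) → z ≠ (-1, 0) →
      P₀ x * P₀ (x + z) = P₀ (x + z) * P₀ x)
    (hc11 : ∀ x z : ZMod L × ZMod L, z ≠ 0 → z ≠ (0, 1) → z ≠ (0, -1) →
      P₁ x * P₁ (x + z) = P₁ (x + z) * P₁ x)
    (hc01 : ∀ x z : ZMod L × ZMod L, z ≠ 0 → z ≠ (1, 0) → z ≠ (0, -1) → z ≠ (1, -1) →
      P₀ x * P₁ (x + z) = P₁ (x + z) * P₀ x)
    (hc10 : ∀ x z : ZMod L × ZMod L, z ≠ 0 → z ≠ (-1, 0) → z ≠ (0, 1) → z ≠ (-1, 1) →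
      P₁ x * P₀ (x + z) = P₀ (x + z) * P₁ x)
    {ε : ℝ} (hε : 0 < ε)
    (hloc : ∀ t : ZMod L × ZMod L,
      (((∑ a ∈ range ℓ, ∑ b ∈ range (ℓ + 1), P₀ (t + ((a : ZMod L), (b : ZMod L)))) +
          ∑ a ∈ range (ℓ + 1), ∑ b ∈ range ℓ, P₁ (t + ((a : ZMod L), (b : ZMod L)))) *
        ((∑ a ∈ range ℓ, ∑ b ∈ range (ℓ + 1), P₀ (t + ((a : ZMod L), (b : ZMod L)))) +
          ∑ a ∈ range (ℓ + 1), ∑ b ∈ range ℓ, P₁ (t + ((a : ZMod L), (b : ZMod L)))) -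
        (ε : ℂ) • ((∑ a ∈ range ℓ, ∑ b ∈ range (ℓ + 1), P₀ (t + ((a : ZMod L), (b : ZMod L)))) +
          ∑ a ∈ range (ℓ + 1), ∑ b ∈ range ℓ, P₁ (t + ((a : ZMod L), (b : ZMod L))))).PosSemidef) :
    ((∑ x, (P₀ x + P₁ x)) * (∑ x, (P₀ x + P₁ x)) -
      ((25 * ((ℓ : ℝ) + 1) * ((ℓ : ℝ) + 2) ^ 2 / (9 * ℓ * (2 * ℓ + 3) ^ 2) *
          (ε - 9 * (5 * (ℓ : ℝ) ^ 2 + 23 * ℓ + 32) / (5 * ((ℓ : ℝ) + 1) * ((ℓ : ℝ) + 2) ^ 2 * ((ℓ : ℝ) + 3)))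
        : ℝ) : ℂ) • ∑ x, (P₀ x + P₁ x)).PosSemidef := by
  have hℓpos : 0 < ℓ := hℓ
  have hℓ0 : (0 : ℝ) < ℓ := by exact_mod_cast hℓ
  have hℓ1 : (0 : ℝ) ≤ (ℓ : ℝ) - 1 := by
    have : (1 : ℝ) ≤ ℓ := by exact_mod_cast hℓ
    linarith
  have hμc : (ℓ : ℝ) = (ℓ : ℕ) := rfl
  have hμd : (ℓ : ℝ) + 1 = ((ℓ + 1 : ℕ) : ℝ) := by norm_cast
  -- closed forms of the one-dimensional sums
  have hS1c := gm_S1 ℓ hμc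
  have hS1d := gm_S1 (ℓ + 1) hμd
  have hS2c := gm_S2 ℓ hμc
  have hS2d := gm_S2 (ℓ + 1) hμd
  have hQ1c := gm_Q1 ℓ hμc hℓ
  have hQ1d := gm_Q1 (ℓ + 1) hμd (by omega)
  rw [Nat.add_sub_cancel] at hQ1d
  have hX := gm_X ℓ
  have h := squareLattice_sq_sub_smul_posSemidef hℓ hL P₀ P₁ hh₀ hi₀ hh₁ hi₁ hc00 hc11 hc01 hc10 hε hloc
    (fun i => ((i : ℝ) + 1) * ((ℓ : ℝ) - i)) (fun i => ((i : ℝ) + 1) * ((ℓ : ℝ) + 1 - i))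
    (fun i hi => gm_w_nonneg hμc hi) (fun i hi => gm_w_nonneg hμd hi)
    (fun t ht => gm_shift_le ℓ hμc t ht)
    (fun t ht => by have h := gm_shift_le (ℓ + 1) hμd t ht; rwa [Nat.add_sub_cancel] at h)
    (fun t => gm_cross_le ℓ t) (fun t => gm_cross_le' ℓ t) (gm_cross_succ ℓ)
    ((ℓ : ℝ) * (ℓ + 1) * (ℓ + 2) * ((ℓ : ℝ) ^ 2 + 2 * ℓ + 2) / 30 *
      (((ℓ : ℝ) + 1) * (ℓ + 2) * (ℓ + 3) * ((ℓ : ℝ) ^ 2 + 4 * ℓ + 5) / 30))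
    ((ℓ : ℝ) * (ℓ - 1) * (ℓ + 1) * (ℓ + 2) * (ℓ + 3) / 30 *
      (((ℓ : ℝ) + 1) * (ℓ + 2) * (ℓ + 3) * ((ℓ : ℝ) ^ 2 + 4 * ℓ + 5) / 30))
    ((ℓ : ℝ) * (ℓ + 1) * (ℓ + 2) * ((ℓ : ℝ) ^ 2 + 2 * ℓ + 2) / 30 *
      ((ℓ : ℝ) * (ℓ + 1) * (ℓ + 2) * (ℓ + 3) * (ℓ + 4) / 30))
    (((ℓ : ℝ) * (ℓ + 1) * (ℓ + 2) * (ℓ + 3) * (2 * ℓ + 3) / 60) ^ 2)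
    (((ℓ : ℝ) * (ℓ + 1) * (ℓ + 2) / 6) ^ 2 * (((ℓ : ℝ) + 1) * (ℓ + 2) * (ℓ + 3) / 6) ^ 2 /
      ((ℓ : ℝ) * (ℓ + 1)))
    (by rw [hS2c, hS2d]; ring) (by rw [hQ1c, hS2d]; ring)
    (by rw [hS2c, hQ1d]; ring) (by rw [hX])
    (by rw [hS1c, hS1d]; ring)
    (by
      have key : ((ℓ : ℝ) * (ℓ + 1) * (ℓ + 2) * (ℓ + 3) * (2 * ℓ + 3) / 60) ^ 2 -
          (ℓ : ℝ) * (ℓ - 1) * (ℓ + 1) * (ℓ + 2) * (ℓ + 3) / 30 *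
            (((ℓ : ℝ) + 1) * (ℓ + 2) * (ℓ + 3) * ((ℓ : ℝ) ^ 2 + 4 * ℓ + 5) / 30) =
          ((ℓ : ℝ) ^ 8 + 16 * (ℓ : ℝ) ^ 7 + 106 * (ℓ : ℝ) ^ 6 + 376 * (ℓ : ℝ) ^ 5 + 769 * (ℓ : ℝ) ^ 4
            + 904 * (ℓ : ℝ) ^ 3 + 564 * (ℓ : ℝ) ^ 2 + 144 * ℓ) / 720 := by ring
      exact sub_nonneg.1 (key ▸ by positivity))
    (by
      have key : ((ℓ : ℝ) * (ℓ + 1) * (ℓ + 2) * (ℓ + 3) * (2 * ℓ + 3) / 60) ^ 2 -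
          (ℓ : ℝ) * (ℓ + 1) * (ℓ + 2) * ((ℓ : ℝ) ^ 2 + 2 * ℓ + 2) / 30 *
            ((ℓ : ℝ) * (ℓ + 1) * (ℓ + 2) * (ℓ + 3) * (ℓ + 4) / 30) =
          (ℓ : ℝ) ^ 2 * ((ℓ : ℝ) - 1) * ((ℓ : ℝ) ^ 5 + 9 * (ℓ : ℝ) ^ 4 + 31 * (ℓ : ℝ) ^ 3
            + 51 * (ℓ : ℝ) ^ 2 + 40 * ℓ + 12) / 720 := by ring
      refine sub_nonneg.1 (key ▸ ?_)
      exact div_nonneg (mul_nonneg (mul_nonneg (sq_nonneg _) hℓ1) (by positivity)) (by norm_num))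
    (by positivity) (by positivity)
  have hℓne : (ℓ : ℝ) ≠ 0 := hℓ0.ne'
  have h1ne : (ℓ : ℝ) + 1 ≠ 0 := by positivity
  have h2ne : (ℓ : ℝ) + 2 ≠ 0 := by positivity
  have h3ne : (ℓ : ℝ) + 3 ≠ 0 := by positivity
  have h23ne : 2 * (ℓ : ℝ) + 3 ≠ 0 := by positivity
  have hq1 : (ℓ : ℝ) ^ 2 + 2 * ℓ + 2 ≠ 0 := by positivity
  have hq2 : (ℓ : ℝ) ^ 2 + 4 * ℓ + 5 ≠ 0 := by positivity
  have hcoef :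
      ((ℓ : ℝ) * (ℓ + 1) * (ℓ + 2) / 6) ^ 2 * (((ℓ : ℝ) + 1) * (ℓ + 2) * (ℓ + 3) / 6) ^ 2 /
            ((ℓ : ℝ) * (ℓ + 1)) /
          ((ℓ : ℝ) * (ℓ + 1) * (ℓ + 2) * (ℓ + 3) * (2 * ℓ + 3) / 60) ^ 2 *
        (ε -
          ((ℓ : ℝ) * (ℓ + 1) * (ℓ + 2) * ((ℓ : ℝ) ^ 2 + 2 * ℓ + 2) / 30 *
                  (((ℓ : ℝ) + 1) * (ℓ + 2) * (ℓ + 3) * ((ℓ : ℝ) ^ 2 + 4 * ℓ + 5) / 30) +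
                ((ℓ : ℝ) * (ℓ + 1) * (ℓ + 2) * (ℓ + 3) * (2 * ℓ + 3) / 60) ^ 2 -
              2 * ((ℓ : ℝ) * (ℓ - 1) * (ℓ + 1) * (ℓ + 2) * (ℓ + 3) / 30 *
                (((ℓ : ℝ) + 1) * (ℓ + 2) * (ℓ + 3) * ((ℓ : ℝ) ^ 2 + 4 * ℓ + 5) / 30))) /
            (((ℓ : ℝ) * (ℓ + 1) * (ℓ + 2) / 6) ^ 2 * (((ℓ : ℝ) + 1) * (ℓ + 2) * (ℓ + 3) / 6) ^ 2 /
              ((ℓ : ℝ) * (ℓ + 1)))) =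
      25 * ((ℓ : ℝ) + 1) * ((ℓ : ℝ) + 2) ^ 2 / (9 * ℓ * (2 * ℓ + 3) ^ 2) *
        (ε - 9 * (5 * (ℓ : ℝ) ^ 2 + 23 * ℓ + 32) / (5 * ((ℓ : ℝ) + 1) * ((ℓ : ℝ) + 2) ^ 2 * ((ℓ : ℝ) + 3))) := by
    field_simp
    ring
  rw [hcoef] at h
  exact h

/-- **The `ℓ⁻²` finite-size criterion on the periodic square lattice** (Gosset–Mozgunov / Lemm–Xiang type, all
`ℓ ≥ 1`): in the setting of `squareLattice_sq_sub_smul_posSemidef` — torus `(ℤ/L)²` with `L ≥ 2ℓ + 2`,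
nearest-neighbour orthogonal projections, every open `ℓ × ℓ` box with local gap `ε` —
`H² - (25/36)(ε - 9/ℓ²) H ≥ 0`, i.e. "`γ_L^per ≥ (25/36)(γ_ℓ - 9/ℓ²)`".  Obtained from
`squareLattice_sq_sub_smul_posSemidef_gmWeights_exact` by `K₄/K₃ ≥ 25/36` (`⟺ 8ℓ² + 23ℓ + 16 ≥ 0`) and
`(K₀+K₃-2K₁)/K₄ ≤ 9/ℓ²` (`⟺ 17ℓ³ + 83ℓ² + 140ℓ + 60 ≥ 0`).  Compare the printed thresholds: Lemm–Xiang
`(25/36)(γ_ℓ - 7.2/ℓ² - 432/ℓ³)` for `ℓ ≥ 10` (optimised weights) [cite: LemmXiang2022, §2.1 Thm. (main result on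
Euclidean lattices), D = 2], Gosset–Mozgunov `(3/4)(ε_n^P - 8/n²)` for their `n × (n+2)` patches
[cite: GossetMozgunov2016, §3 Thm. 5]; the constant `9` here is what the un-optimised (`λ = 0`) weights give, valid
for every `ℓ ≥ 1` and with no translation-invariance assumption. -/
theorem squareLattice_sq_sub_smul_posSemidef_gmWeights {L : ℕ} [NeZero L] {ℓ : ℕ}
    (hℓ : 1 ≤ ℓ) (hL : 2 * ℓ + 2 ≤ L) (P₀ P₁ : ZMod L × ZMod L → Matrix n n ℂ) (hh₀ : ∀ x, (P₀ x).IsHermitian)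
    (hi₀ : ∀ x, P₀ x * P₀ x = P₀ x) (hh₁ : ∀ x, (P₁ x).IsHermitian) (hi₁ : ∀ x, P₁ x * P₁ x = P₁ x)
    (hc00 : ∀ x z : ZMod L × ZMod L, z ≠ 0 → z ≠ (1, 0) → z ≠ (-1, 0) →
      P₀ x * P₀ (x + z) = P₀ (x + z) * P₀ x)
    (hc11 : ∀ x z : ZMod L × ZMod L, z ≠ 0 → z ≠ (0, 1) → z ≠ (0, -1) →
      P₁ x * P₁ (x + z) = P₁ (x + z) * P₁ x)
    (hc01 : ∀ x z : ZMod L × ZMod L, z ≠ 0 → z ≠ (1, 0) → z ≠ (0, -1) → z ≠ (1, -1) →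
      P₀ x * P₁ (x + z) = P₁ (x + z) * P₀ x)
    (hc10 : ∀ x z : ZMod L × ZMod L, z ≠ 0 → z ≠ (-1, 0) → z ≠ (0, 1) → z ≠ (-1, 1) →
      P₁ x * P₀ (x + z) = P₀ (x + z) * P₁ x)
    {ε : ℝ} (hε : 0 < ε)
    (hloc : ∀ t : ZMod L × ZMod L,
      (((∑ a ∈ range ℓ, ∑ b ∈ range (ℓ + 1), P₀ (t + ((a : ZMod L), (b : ZMod L)))) +
          ∑ a ∈ range (ℓ + 1), ∑ b ∈ range ℓ, P₁ (t + ((a : ZMod L), (b : ZMod L)))) *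
        ((∑ a ∈ range ℓ, ∑ b ∈ range (ℓ + 1), P₀ (t + ((a : ZMod L), (b : ZMod L)))) +
          ∑ a ∈ range (ℓ + 1), ∑ b ∈ range ℓ, P₁ (t + ((a : ZMod L), (b : ZMod L)))) -
        (ε : ℂ) • ((∑ a ∈ range ℓ, ∑ b ∈ range (ℓ + 1), P₀ (t + ((a : ZMod L), (b : ZMod L)))) +
          ∑ a ∈ range (ℓ + 1), ∑ b ∈ range ℓ, P₁ (t + ((a : ZMod L), (b : ZMod L))))).PosSemidef) :
    ((∑ x, (P₀ x + P₁ x)) * (∑ x, (P₀ x + P₁ x)) -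
      (((25 : ℝ) / 36 * (ε - 9 / (ℓ : ℝ) ^ 2) : ℝ) : ℂ) • ∑ x, (P₀ x + P₁ x)).PosSemidef := by
  have hℓ0 : (0 : ℝ) < ℓ := by exact_mod_cast hℓ
  have hH : (∑ x, (P₀ x + P₁ x)).PosSemidef :=
    posSemidef_sum _ fun x _ => (posSemidef_of_isHermitian_of_mul_self (hh₀ x) (hi₀ x)).add
      (posSemidef_of_isHermitian_of_mul_self (hh₁ x) (hi₁ x))
  have h := squareLattice_sq_sub_smul_posSemidef_gmWeights_exact hℓ hL P₀ P₁ hh₀ hi₀ hh₁ hi₁ hc00 hc11 hc01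
    hc10 hε hloc
  obtain ⟨F, hF⟩ : ∃ F : ℝ, F = 25 * ((ℓ : ℝ) + 1) * ((ℓ : ℝ) + 2) ^ 2 / (9 * ℓ * (2 * ℓ + 3) ^ 2) := ⟨_, rfl⟩
  obtain ⟨G, hG⟩ : ∃ G : ℝ,
      G = 9 * (5 * (ℓ : ℝ) ^ 2 + 23 * ℓ + 32) / (5 * ((ℓ : ℝ) + 1) * ((ℓ : ℝ) + 2) ^ 2 * ((ℓ : ℝ) + 3)) :=
    ⟨_, rfl⟩
  rw [← hF, ← hG] at h
  have hℓne : (ℓ : ℝ) ≠ 0 := hℓ0.ne'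
  have h1ne : (ℓ : ℝ) + 1 ≠ 0 := by positivity
  have h2ne : (ℓ : ℝ) + 2 ≠ 0 := by positivity
  have h3ne : (ℓ : ℝ) + 3 ≠ 0 := by positivity
  have h23ne : 2 * (ℓ : ℝ) + 3 ≠ 0 := by positivity
  have hF' : 25 / 36 ≤ F := by
    have key : F - 25 / 36 = 25 * (8 * (ℓ : ℝ) ^ 2 + 23 * ℓ + 16) / (36 * ℓ * (2 * ℓ + 3) ^ 2) := by
      rw [hF]
      field_simp
      ring
    exact sub_nonneg.1 (key ▸ by positivity)
  have hG' : G ≤ 9 / (ℓ : ℝ) ^ 2 := by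
    have key : 9 / (ℓ : ℝ) ^ 2 - G = 9 * (17 * (ℓ : ℝ) ^ 3 + 83 * (ℓ : ℝ) ^ 2 + 140 * ℓ + 60) /
        (5 * (ℓ : ℝ) ^ 2 * ((ℓ : ℝ) + 1) * ((ℓ : ℝ) + 2) ^ 2 * ((ℓ : ℝ) + 3)) := by
      rw [hG]
      field_simp
      ring
    exact sub_nonneg.1 (key ▸ by positivity)
  by_cases hκ : (25 : ℝ) / 36 * (ε - 9 / (ℓ : ℝ) ^ 2) ≤ 0
  · exact sq_sub_smul_posSemidef_of_nonpos hH hκ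
  · have hεG : 0 ≤ ε - G := by
      push Not at hκ
      nlinarith
    have hle : (25 : ℝ) / 36 * (ε - 9 / (ℓ : ℝ) ^ 2) ≤ F * (ε - G) := by
      nlinarith [mul_nonneg (sub_nonneg.2 hF') hεG]
    exact sq_sub_smul_posSemidef_of_le hH hle h

/-- The printed (eigenvalue) form of `squareLattice_sq_sub_smul_posSemidef_gmWeights`: every eigenvalue of the torus
Hamiltonian is `0` or at least `(25/36)(ε - 9/ℓ²)`; in particular "`γ_L^per ≥ (25/36)(γ_ℓ - 9/ℓ²)`".
[cite: LemmXiang2022, §2.1 eq. (generic) and Thm. (main), D = 2] [cite: GossetMozgunov2016, §3 Thm. 5] -/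
theorem squareLattice_sq_sub_smul_posSemidef_gmWeights_eigenvalue_eq_zero_or_le {L : ℕ} [NeZero L] {ℓ : ℕ}
    (hℓ : 1 ≤ ℓ) (hL : 2 * ℓ + 2 ≤ L) (P₀ P₁ : ZMod L × ZMod L → Matrix n n ℂ) (hh₀ : ∀ x, (P₀ x).IsHermitian)
    (hi₀ : ∀ x, P₀ x * P₀ x = P₀ x) (hh₁ : ∀ x, (P₁ x).IsHermitian) (hi₁ : ∀ x, P₁ x * P₁ x = P₁ x)
    (hc00 : ∀ x z : ZMod L × ZMod L, z ≠ 0 → z ≠ (1, 0) → z ≠ (-1, 0) →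
      P₀ x * P₀ (x + z) = P₀ (x + z) * P₀ x)
    (hc11 : ∀ x z : ZMod L × ZMod L, z ≠ 0 → z ≠ (0, 1) → z ≠ (0, -1) →
      P₁ x * P₁ (x + z) = P₁ (x + z) * P₁ x)
    (hc01 : ∀ x z : ZMod L × ZMod L, z ≠ 0 → z ≠ (1, 0) → z ≠ (0, -1) → z ≠ (1, -1) →
      P₀ x * P₁ (x + z) = P₁ (x + z) * P₀ x)
    (hc10 : ∀ x z : ZMod L × ZMod L, z ≠ 0 → z ≠ (-1, 0) → z ≠ (0, 1) → z ≠ (-1, 1) →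
      P₁ x * P₀ (x + z) = P₀ (x + z) * P₁ x)
    {ε : ℝ} (hε : 0 < ε)
    (hloc : ∀ t : ZMod L × ZMod L,
      (((∑ a ∈ range ℓ, ∑ b ∈ range (ℓ + 1), P₀ (t + ((a : ZMod L), (b : ZMod L)))) +
          ∑ a ∈ range (ℓ + 1), ∑ b ∈ range ℓ, P₁ (t + ((a : ZMod L), (b : ZMod L)))) *
        ((∑ a ∈ range ℓ, ∑ b ∈ range (ℓ + 1), P₀ (t + ((a : ZMod L), (b : ZMod L)))) +
          ∑ a ∈ range (ℓ + 1), ∑ b ∈ range ℓ, P₁ (t + ((a : ZMod L), (b : ZMod L)))) -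
        (ε : ℂ) • ((∑ a ∈ range ℓ, ∑ b ∈ range (ℓ + 1), P₀ (t + ((a : ZMod L), (b : ZMod L)))) +
          ∑ a ∈ range (ℓ + 1), ∑ b ∈ range ℓ, P₁ (t + ((a : ZMod L), (b : ZMod L))))).PosSemidef)
    {μ : ℝ} {v : n → ℂ} (hv : (∑ x, (P₀ x + P₁ x)) *ᵥ v = (μ : ℂ) • v) (hv0 : v ≠ 0) :
    μ = 0 ∨ (25 : ℝ) / 36 * (ε - 9 / (ℓ : ℝ) ^ 2) ≤ μ := by
  have hH : (∑ x, (P₀ x + P₁ x)).PosSemidef :=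
    posSemidef_sum _ fun x _ => (posSemidef_of_isHermitian_of_mul_self (hh₀ x) (hi₀ x)).add
      (posSemidef_of_isHermitian_of_mul_self (hh₁ x) (hi₁ x))
  exact eigenvalue_eq_zero_or_le_of_sq_sub_smul_posSemidef hH
    (squareLattice_sq_sub_smul_posSemidef_gmWeights hℓ hL P₀ P₁ hh₀ hi₀ hh₁ hi₁ hc00 hc11 hc01 hc10 hε hloc)
    hv hv0

end SquareLattice

end Literature.MathematicalPhysics.QuantumLattice

end
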